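import Literature.MathematicalPhysics.QuantumFieldTheory.Balaban1983to89.B3Op116DKernelRegularBox
import Literature.MathematicalPhysics.QuantumFieldTheory.Balaban1983to89.B3Op116FaceSumsSubOne
import Literature.MathematicalPhysics.QuantumFieldTheory.Balaban1983to89.B3Op116HolderKernelRegularRegion
import Literature.MathematicalPhysics.QuantumFieldTheory.Balaban1983to89.B3Op116CellBoxFaceFamily
import Literature.MathematicalPhysics.QuantumFieldTheory.Balaban1983to89.B3Op116BoxRows

/-!
# `Balaban1983to89.B3Op116HolderKernelRegularBox` — T. Bałaban, *(Higgs)₂,₃ quantum fields in a finite volume. III. Renormalization*,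
# Commun. Math. Phys. **88** (1983) 411–445 [Balaban1983Higgs3], (1.16) p. 414 / (2.5)–(2.6) p. 424 / (2.10)–(2.11) p. 426 / p. 433:
# **THE HÖLDER QUOTIENT OF THE ROW DERIVATIVE OF THE KERNEL OF (1.16) ON A `k`-BLOCK UNION `□` — PERTURBATION SUPPORTED UP TO `∂□` — AT BONDS ONE
# TOP BLOCK INSIDE THE FACES IS UNIFORMLY BOUNDED AND EXPONENTIALLY DECAYING, FOR ALL `n + 1 + n′ + 1 − α > d`**: the box twin of
# `B3Op116HolderKernelRegularTorus.kernel116_holder_le` — the last insertion read through the two-anchor Hölder column (exponent `1 − α`), the inner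
# field through the box state of `B3Op116DKernelRegularBox`, the end sheet on `∂□` through `B3Op116FaceSumsSubOne` (exponent `1 − α`, margin `θL^k`);
# its `n = 0` corner (outer factor `G_k(Ω,Ã+B̃)`, the box twin of `B3Op116HolderKernelRegularTorusZero` / `…RegularRegion` v1.1) —
# and the (C)-level PLUGS on a cell-product box `□ = cellBox k K₀ S` (p35 g21's `B3Op116BoxRows.{colB_dcolB_le, hcolB_le}`) — F5-H (Hölder member) of
# p35 `DESIGN-FILE4.md` §14 (d)–(e) / §17

statement-level skeleton of published theorems with citation tags; proofs where landed; nothing here is a claim about the Yang–Mills mass gap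

PDF held: `paper:balaban1983-higgs-2-3-quantum-fields-finite-volume` (journal page = PDF page + 410; p. 414 = `p0004.txt`, p. 426 = `p0016.txt`,
p. 433 = `p0023.txt`); `paper:balaban1982-cmp85-higgs23-i` (Prop. 2.1 (2.24) p. 610, (3.44) p. 619).

CITATION HEADER (lean-in-tree rule).  T. Bałaban, CMP **88** (1983) 411–445 [Balaban1983Higgs3]: (1.16) p. 414, (2.5)/(2.6) p. 424, (2.10)–(2.11)
p. 426, p. 433; part I, CMP **85** (1982) 603–636 [Balaban1982Higgs1]: Prop. 2.1 (2.24) p. 610, (3.16) p. 615, (2.20) p. 610, (3.44) p. 619.  Cell `lit-balaban`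
(HOME `run/shared/lean/pub/lit-balaban/`), Phase-2 proof seat **p35** gen 27 (literature-prover-lit-balaban-p35-g27-0; free-target protocol G.5-34(d),
TAKING HOME/STATUS.md 2026-08-23T16:58:04Z + addendum, cc p40 / r15 / r14 / p33).  SKELETON rows **B3.Eq1.16** / **B3.Eq2.5** / **B3.Eq2.11** /
**B3.Txt@433** / **B3.Prop1** (owner r15) — LOCATED MEMBER (no head claim) of the «(2.5) for (1.16) on a cell-product box `□` without the support
clause» programme (GAPS.md G-B3-16.A1, route γ′).  USED BY NAME, never restated: p35 g27's `B3Op116CollarRowReduce.{collar_row_reduce, kapF}`,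
`B3Op116DKernelRegularBox.{BoxState, rateB, cvB, cdB, cSB, seqB_pos, seqB_succ, step_state_box, base_state_box, state_op116_box_cb}`, p35 g23's
`B3Op116HolderKernelRegularRegion.op116_zero_succ_split_region` ((I.3.44) read from the left, EVERY `Ω`), this seat's `B3Op116CellBoxFaceFamily.{faceFam,
faceFam_level, exB_cover_cellBox, enB_cover_cellBox, height_faceFam, dcol_split_le_maj, inside_of_interior, faces_height_of_interior}`, r14's
`B3Ineq210RegularRegion.Interior`, p35 g21's `B3Op116BoxRows.{colB_dcolB_le, hcolB_le}`,
`B3Ineq211RegularTorus.{IsAdm, one_le_tdist_of_ne'}`, `B3Ineq210RegularBox.cellBox_blockUnion`,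
`B3Op116FaceSumsSubOne.face_sum_kernel_le_one_margin_le`, `B3Op116DKernelRegularBox.stepBoxC_zero_sheet`, p35 g26's
`B3Op116MajorantStepBox.{row_step_box_deriv_le, stepBoxC}`, p35 g23's `B3Op116HolderKernelRegularTorus.{holT, holT_apply, row_le_of_kernel_le_add,
exp_add_exp_le_two_exp_min, mesh_rpow_split_holder}`, `B3Op116MajorantStep.{maj, row_step_le, stepC}`, p40 g77's
`B3Op116CollarHolder.holT_propagatorK_single_eq_zero`, p33's `B3Op116MajorantConvolution.majorant_le_top`, `B3Op116DKernelRegularTorus.{kap4, rate_div_eq}`.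

WHAT IS PRINTED (verbatim).  p. 414 [PDF 4]: *"More exactly the Hölder norms of the covariant derivatives of this kernel, the norms defined for
example in the inequalities (I.2.24) and (I.2.25) of Proposition I.2.1, are exponentially decaying with the distance of the arguments and are uniformly
bounded by O(1)(e(L^kε)^{1−α})^{n+n′}, where α > 0 but can be arbitrarily small."*  p. 426 (2.11) and *"This applies also to Hölder norms"*.  p. 433
[PDF 23]: *"we take a cube □ of size 3r(L^kε) and with □₁ in the center. We assume that □₁, □ are sums of big blocks … We have B̃ = B̃₀ + B̃′, and we
expand in B̃′ … we include the operators (1.16) … into the external fields."*  [B1] p. 619 (3.44) [PDF 17]: *"G_k(Ω,A+B) = G_k(Ω,B) + G_k(Ω,B)[…]G_k(Ω,A+B)"*.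

WHAT THIS FILE PROVES.  `Ω` a union of `k`-blocks, `m² > 0`, `a_k ≥ 0`, `1 ≤ k ≤ K`, `L > 1`; `sup|A| ≤ s`, `A` regular with `δ_A` on `T_ε`; the (2.10)
dictionary of `G_k(Ω,B)` and `G_k(Ω,A+B)` on `Ω` (constants `c_{K2}`, `c_{K1}`, rate `0 < δ₁ ≤ 1`) and a face family `F_i ⊆ {u_{ν_i} = c_i}` covering the
legs (as in `B3Op116DKernelRegularBox`); the two collinear bonds `⟨x₁,x₁+εe_μ⟩, ⟨x₂,x₂+εe_μ⟩ ⊂ Ω` and a contour `Γ`; the TWO-ANCHOR HÖLDER DICTIONARY of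
the last propagator `G_k(Ω,B)` on `Ω`: `Σ_i‖U(B(Γ))(D^ε_BG_k(Ω,B)e_{(y,i)})(⟨x₂,μ⟩) − (D^ε_BG_k(Ω,B)e_{(y,i)})(⟨x₁,μ⟩)‖ ≤ q·(𝔪_k(c_H,1−α;δ₁)(x₁,y) + 𝔪_k(c_H,1−α;δ₁)(x₂,y))`
for `y ∈ Ω` (`0 ≤ α < 1`, any `q ≥ 0` — the (2.11) member with `q = (ε|x₁−x₂|)^α`, p35 g21 `B3Op116BoxRows.hcolB_le` on a cell-product box); both anchors at
height `≥ θL^k` above every face level.  THEN (`sheetHolC`, `holCBθ` explicit; §2 the ENGINE **`holder_row_boxState_le`** = the Hölder row of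
`G_k(Ω,B)V_k^Ω` over ANY family of inner fields in `BoxState(J)`) §3 **`kernel116_holder_box_margin_le`**: for every `n, n′` with
`d < 1 + (n+1+n′) − α` and every `x′ ∈ Ω`,
`ε^{−d}Σ_{i′}‖U(B(Γ))(D^ε_B(1.16)^Ω_{n+1,n′}e_{(x′,i′)})(⟨x₂,μ⟩) − (D^ε_B(1.16)^Ω_{n+1,n′}e_{(x′,i′)})(⟨x₁,μ⟩)‖
  ≤ q·holCBθ(n+n′)·(L^kε)^{n+1+n′}·((L^kε)((L^kε)^d)^{−1}((L^kε)^α)^{−1})·exp(−δ_{n+1+n′}·min(|x₁−x′|,|x₂−x′|)/L^k)`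
— p40's binder shape `hH` (`B3Ineq25Op116SmoothInner`), UNIFORM IN `k`: the located Leibniz row reduced to the three-slot row (`collar_row_reduce`), the
two-anchor kernel split (`row_le_of_kernel_le_add`), each anchor one box step at `a_K = 1 − α` (`row_step_box_deriv_le`; at `n + n′ = 0` the sheet-free
`row_step_le`), the end sheet at each anchor by `face_sum_kernel_le_one_margin_le` (`r = 1 − α`).  §4 `state_chainB_box`: the PURE-`B` chain `G_k(Ω,B)(V_k^ΩG_k(Ω,B))^m e_{(x′,i′)}` is in
`BoxState(m)`.  §5 THE `n = 0` CORNER **`kernel116_holder_box_zero_left_margin_le`** (needs `a > 0`): for `d < 1 + (n′+1) − α`,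
`ε^{−d}Σ_{i′}‖U(B(Γ))(D^ε_B(1.16)^Ω_{0,n′+1}e)(⟨x₂,μ⟩) − (D^ε_B(1.16)^Ω_{0,n′+1}e)(⟨x₁,μ⟩)‖
  ≤ q·(holCBθ(n′)(L^kε)^{n′+1} + holCBθ(n′+1)(L^kε)^{n′+2})·((L^kε)((L^kε)^d)^{−1}((L^kε)^α)^{−1})·e^{−δ_{n′+2}min(|x₁−x′|,|x₂−x′|)/L^k}`
by the (I.3.44) split `(1.16)_{0,n′+1}e = G_BV_k·[G_B(V_kG_B)^{n′}e] + (1.16)_{1,n′+1}e` (engine at the chain + §3 at `(1, n′+1)`, common rate `δ_{n′+2}`);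
packaged `kernel116_holder_box_zero_left_margin_le'` (`L^kε ≤ 1`, one constant `(holCBθ(n′)+holCBθ(n′+1))(L^kε)^{n′+1}` = p40's `hH` at `(0, n′+1)`).
§6 THE (C)-LEVEL PLUGS on `□ = cellBox k K₀ S`: **`kernel116_holder_cellBox_margin_le`** / **`kernel116_holder_cellBox_zero_left_margin_le`**: ∃ `K₀,min`,
∀ `0 ≤ α < 1`, ∀ `K₀ ≥ K₀,min` ∃ `t, δ₁ ≤ 1, C > 0` such that for every volume with the given `d ≥ 1`, `L ≥ 2`, `K₀ ∣ M`, every `1 ≤ k ≤ K` with `L^kε ≤ 1`,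
`3·half ≤ |T|_μ`, every `S`, every `A` with `sup|A| ≤ s`, `δ_A`-regular on `T_ε` (NO support clause), every `B` and `A + B` `δ`-regular on `□` with
`L^kδ|e| ≤ t`, all admissible orders, every `x′ ∈ □`, every pair of collinear bonds `⊂ □`, `x₁ ≠ x₂`, both `θL^k` above every face slice, every admissible
contour `Γ ⊂ □`: the bounds of §3 / §5 with `q = (ε|x₁−x₂|)^α`, `c_H = c_{K2} = ε^dC` — from `colB_dcolB_le` + `hcolB_le` at the common rate `min(δ₁,δ₂,1)`
and constant `max(C₁,C₂)`.
§7 **`kernel116_holder_cellBox_interior_le`** / **`kernel116_holder_cellBox_zero_left_interior_le`**: §6 with both anchors `Interior k K₀ □` points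
(r14's `Interior`; bonds and heights discharged by `B3Op116CellBoxFaceFamily.{inside_of_interior, faces_height_of_interior}`, `θ = 1`) — p40's binder
`hH` on `Ω = □` except that the admissible contour must lie in `□`.
HONEST SCOPE.  §2–§5 are (B)-level (dictionaries, regularity, face family, heights = hypotheses); §6–§7 discharge them on cell-product boxes.  At bonds
closer than `θL^k` to a face the end sheet is NOT uniform in `k` (not claimed); the near/far split of the Hölder quotient in `|x₁ − x₂|` and the `B`- versus
`(A+B)`-transport conversions are the assembly's (p40).  `n = n′ = 0` (no `V_k`) is below every threshold.  The mixed/dipole seeds are not here.  Two `def`s (`sheetHolC`, `holCBθ`: displayed constants); no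
`def … : Prop`, no new named fact, no `sorry`; axioms standard.  Value = located member of a by-reference step of B3 — NOT summit progress.
-/

noncomputable section

open scoped BigOperators

namespace Literature.MathematicalPhysics.QuantumFieldTheory.Balaban1983to89.B3Op116HolderKernelRegularBox

open HiggsLattice (ChargeData ScalarField covDeriv)
open HiggsCovariance (propagatorK E)
open HiggsCovariancePos (Inside)
open HiggsAveraging (blockK blockIter)
open B1Eq230FluctCov (Ix cb)
open B1TorusChainTransport (hol)
open B3Ineq210MixedRegularTorus (cb_eq_single)
open B3Op116SourceForm (srcV op116_succ_left_apply)
open B3Op116MajorantStep (maj maj_nonneg maj_rate_mono maj_add mul_maj stepC stepC_nonneg row_step_le maj_const_mono)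
open B3Op116MajorantStepBox (stepBoxC stepBoxC_nonneg row_step_box_deriv_le)
open B3Op116MajorantConvolution (majorant_le_top)
open B3Op116CollarSources (inB exB enB mem_inB)
open B3Op116CollarHolder (holT_propagatorK_single_eq_zero)
open B3Op116HolderKernelRegularTorus (holT holT_apply row_le_of_kernel_le_add exp_add_exp_le_two_exp_min mesh_rpow_split_holder)
open B3Op116DKernelRegularTorus (kap4 kap4_nonneg rate_div_eq cK1 cK1_ge)
open B3Op116CollarRowReduce (kapF kapF_nonneg collar_row_reduce)
open B3Op116DKernelRegularBox (stepBoxC_zero_sheet BoxState rateB cvB cdB cSB seqB_pos seqB_zero seqB_succ state_op116_box_cb step_state_box base_state_box)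
open B3Op116FaceSumsSubOne (face_sum_kernel_le_one_margin_le)
open B3Eq116TwoSidedExpansion (op116)
open B3Op116HolderKernelRegularRegion (op116_zero_succ_split_region)
open B1TorusCubeCover (half)
open B1Ineq225RegularBox (cellBox)
open B3Ineq210RegularBox (cellBox_blockUnion)
open B3Ineq211RegularTorus (IsAdm one_le_tdist_of_ne')
open B3Op116CollarBoxFaces (faces)
open B3Op116BoxRows (colB_dcolB_le hcolB_le)
open B3Op116CellBoxFaceFamily (faceFam faceFam_level exB_cover_cellBox enB_cover_cellBox height_faceFam dcol_split_le_maj)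

variable {P : HiggsLattice.Params} {N : ℕ}

/-! ## §1 The constants -/

section Constants

/-- the end-sheet constant of one face read through a Hölder column of exponent `1 − α` at height `≥ θL^k` (`B3Op116FaceSumsSubOne`, `r = 1 − α`):
`c_H·c_v·(8d/δ)^{d−1}(ε^{d−1})^{−1}·(θ^{−α}(1+4d/δ)r₁/(1−r₁) + L^{s−1}/(L^{s−1}−1))`, `r₁ = e^{−(δ/2)θ(L−1)/(2d)}`. [cite: Balaban1983Higgs3, (1.16) p.414, (2.11) p.426, p.433] -/
def sheetHolC (P : HiggsLattice.Params) (δ θ α s cH cv : ℝ) : ℝ :=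
  cH * cv * ((8 * P.d / δ) ^ (P.d - 1) * (P.mesh 0 ^ (P.d - 1))⁻¹ *
    (θ ^ ((1 - α) - 1) * ((1 + 4 * P.d / δ) *
        (Real.exp (-(δ / 2 * θ * ((P.L : ℝ) - 1) / (2 * P.d))) / (1 - Real.exp (-(δ / 2 * θ * ((P.L : ℝ) - 1) / (2 * P.d))))))
      + (P.L : ℝ) ^ (s - 1) / ((P.L : ℝ) ^ (s - 1) - 1)))

/-- `sheetHolC ≥ 0` (`δ, θ > 0`, `L > 1`, `s > 1`, `c_H, c_v ≥ 0`). [cite: Balaban1983Higgs3, (2.11) p.426] -/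
theorem sheetHolC_nonneg (hL : 1 < P.L) {δ θ α s cH cv : ℝ} (hδ : 0 < δ) (hθ : 0 < θ) (hs : 1 < s) (hcH : 0 ≤ cH) (hcv : 0 ≤ cv) :
    0 ≤ sheetHolC P δ θ α s cH cv := by
  have hL1 : (1 : ℝ) < (P.L : ℝ) := by exact_mod_cast hL
  have hd0 : (0 : ℝ) < P.d := by exact_mod_cast P.hd
  have ha0 : 0 < δ / 2 * θ * ((P.L : ℝ) - 1) / (2 * P.d) := div_pos (mul_pos (mul_pos (half_pos hδ) hθ) (by linarith)) (by positivity)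
  have hr1 : Real.exp (-(δ / 2 * θ * ((P.L : ℝ) - 1) / (2 * P.d))) < 1 := Real.exp_lt_one_iff.mpr (by linarith)
  have h1 : 0 ≤ Real.exp (-(δ / 2 * θ * ((P.L : ℝ) - 1) / (2 * P.d))) / (1 - Real.exp (-(δ / 2 * θ * ((P.L : ℝ) - 1) / (2 * P.d)))) :=
    div_nonneg (Real.exp_nonneg _) (by linarith)
  have h2 : 0 < (P.L : ℝ) ^ (s - 1) - 1 := by have := Real.one_lt_rpow hL1 (by linarith : 0 < s - 1); linarith
  have h3 : 0 ≤ (P.L : ℝ) ^ (s - 1) := Real.rpow_nonneg (by positivity) _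
  have h4 : 0 ≤ (P.mesh 0 ^ (P.d - 1))⁻¹ := inv_nonneg.mpr (pow_nonneg (P.mesh_pos 0).le _)
  have h5 : 0 ≤ θ ^ ((1 - α) - 1) := Real.rpow_nonneg hθ.le _
  unfold sheetHolC
  positivity

/-- the Hölder constant with the margin: `2ε^{−d}·N·(stepBoxC(1−α, 2+J, c_H, state J) + κ_F·n_F·sheetHolC(δ_J, θ, α, 2+J, c_H, cv_J))/(L^{1+(J+1)−α−d} − 1)`
(`J = n + n′` the state index of the inner field). [cite: Balaban1983Higgs3, (1.16) p.414, (2.11) p.426] -/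
def holCBθ (P : HiggsLattice.Params) (N : ℕ) (C : ChargeData N) (k nF : ℕ) (a cK2 cK1 s δA δ₁ α cH θ : ℝ) (J : ℕ) : ℝ :=
  2 * ((P.mesh 0 ^ P.d)⁻¹ * (Fintype.card (Ix N) : ℝ) *
    ((stepBoxC P N k nF (rateB P N C k nF a cK2 cK1 s δA δ₁ cK2 cK1 J) (1 - α) (2 + (J : ℝ)) cH
          (cvB P N C k nF a cK2 cK1 s δA δ₁ cK2 cK1 J) (cdB P N C k nF a cK2 cK1 s δA δ₁ cK2 cK1 J) (cSB P N C k nF a cK2 cK1 s δA δ₁ cK2 cK1 J) cK1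
          (|C.e| * s) ((P.mesh 0)⁻¹ * (|C.e| * δA)) ((|C.e| * s) ^ 2) (kap4 P C k a s)
        + kapF P C s δA * (nF : ℝ) *
          sheetHolC P (rateB P N C k nF a cK2 cK1 s δA δ₁ cK2 cK1 J) θ α (2 + (J : ℝ)) cH (cvB P N C k nF a cK2 cK1 s δA δ₁ cK2 cK1 J))
      / ((P.L : ℝ) ^ ((1 : ℝ) + ((J + 1 : ℕ) : ℝ) - α - (P.d : ℝ)) - 1)))

/-- `holCBθ ≥ 0` (`0 < δ₁ ≤ 1`, seeds `c_{K2}, c_{K1} ≥ 0`, `s, δ_A ≥ 0`, `α < 1`, `c_H ≥ 0`, `θ > 0`, `d < 1 + (J+1) − α`). [cite: Balaban1983Higgs3, (2.11) p.426] -/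
theorem holCBθ_nonneg (hL : 1 < P.L) {C : ChargeData N} (k nF : ℕ) {a cK2 cK1 s δA δ₁ α cH θ : ℝ} (hδ₁ : 0 < δ₁) (hδ₁1 : δ₁ ≤ 1)
    (hcK2 : 0 ≤ cK2) (hcK1 : 0 ≤ cK1) (hs : 0 ≤ s) (hδA : 0 ≤ δA) (hα1 : α < 1) (hcH : 0 ≤ cH) (hθ : 0 < θ) (J : ℕ)
    (hd : (P.d : ℝ) < 1 + ((J + 1 : ℕ) : ℝ) - α) :
    0 ≤ holCBθ P N C k nF a cK2 cK1 s δA δ₁ α cH θ J := by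
  have hL1 : (1 : ℝ) < (P.L : ℝ) := by exact_mod_cast hL
  obtain ⟨hr0, hrδ, hcv0, hcd0, hcS0⟩ := seqB_pos (P := P) (N := N) (C := C) (k := k) (nF := nF) (a := a) (cK2 := cK2) (cK1 := cK1)
    (s := s) (δA := δA) (δ₀ := δ₁) (cv₀ := cK2) (cd₀ := cK1) hL hδ₁ le_rfl hcK2 hcK1 hcK2 hcK1 hs hδA J
  have hes : 0 ≤ |C.e| * s := mul_nonneg (abs_nonneg _) hs
  have hκ₂ : 0 ≤ (P.mesh 0)⁻¹ * (|C.e| * δA) := mul_nonneg (inv_nonneg.mpr (P.mesh_pos 0).le) (mul_nonneg (abs_nonneg _) hδA)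
  have hκ₄ : 0 ≤ kap4 P C k a s := kap4_nonneg hs
  have hκF : 0 ≤ kapF P C s δA := kapF_nonneg hs hδA
  have haK : 0 < 1 - α := by linarith
  have hδJ1 : rateB P N C k nF a cK2 cK1 s δA δ₁ cK2 cK1 J ≤ 1 := hrδ.trans hδ₁1
  have hsJ : (1 : ℝ) < 2 + (J : ℝ) := by have := (Nat.cast_nonneg J : (0:ℝ) ≤ J); linarith
  have hcR0 : 0 ≤ stepBoxC P N k nF (rateB P N C k nF a cK2 cK1 s δA δ₁ cK2 cK1 J) (1 - α) (2 + (J : ℝ)) cH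
      (cvB P N C k nF a cK2 cK1 s δA δ₁ cK2 cK1 J) (cdB P N C k nF a cK2 cK1 s δA δ₁ cK2 cK1 J) (cSB P N C k nF a cK2 cK1 s δA δ₁ cK2 cK1 J) cK1
      (|C.e| * s) ((P.mesh 0)⁻¹ * (|C.e| * δA)) ((|C.e| * s) ^ 2) (kap4 P C k a s) := by
    rcases Nat.eq_zero_or_pos J with hJ0 | hJpos
    · have hS00 : cSB P N C k nF a cK2 cK1 s δA δ₁ cK2 cK1 J = 0 := by rw [hJ0]; rfl
      rw [hS00, stepBoxC_zero_sheet]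
      exact stepC_nonneg hL k hr0 haK hsJ hcH hcv0 hcd0 hes hκ₂ (sq_nonneg _) hκ₄
    · have hav : (2 : ℝ) < 2 + (J : ℝ) := by
        have h0J : (0 : ℝ) < (J : ℝ) := Nat.cast_pos.mpr hJpos
        linarith
      exact stepBoxC_nonneg hL k nF hr0 haK hav hcH hcv0 hcd0 hcS0 hcK1 hes hκ₂ (sq_nonneg _) hκ₄
  have hcF0 := sheetHolC_nonneg hL (α := α) hr0 hθ hsJ hcH hcv0
  have hgeom : 0 < (P.L : ℝ) ^ ((1 : ℝ) + ((J + 1 : ℕ) : ℝ) - α - (P.d : ℝ)) - 1 := by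
    have : (1 : ℝ) < (P.L : ℝ) ^ ((1 : ℝ) + ((J + 1 : ℕ) : ℝ) - α - (P.d : ℝ)) := Real.one_lt_rpow hL1 (by linarith)
    linarith
  have hε : 0 ≤ (P.mesh 0 ^ P.d)⁻¹ := inv_nonneg.mpr (pow_nonneg (P.mesh_pos 0).le _)
  unfold holCBθ
  positivity

end Constants

/-! ## §2 The Hölder row of `G_k(Ω,B)V_k^Ω` over a family of inner fields in the box state `J`, anchors one top block inside the faces -/

section Row

variable {C : ChargeData N} {Ω : Finset (HiggsLattice.Site P 0)} {A B : HiggsLattice.VecField P 0} {msq a : ℝ} {k : ℕ}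
  {δ₁ s δA cK2 cK1 α cH q θ : ℝ} {nF : ℕ} {F : Fin nF → Finset (HiggsLattice.Site P 0)} {ν : Fin nF → Fin P.d}
  {c : (i : Fin nF) → ZMod (P.sitesPerDir 0 (ν i))} {x₁ x₂ : HiggsLattice.Site P 0} {μ : Fin P.d} {Γ : List (HiggsLattice.Site P 0)}

variable (hL : 1 < P.L) (hk : 1 ≤ k) (hkK : k ≤ P.K) (hmsq : 0 < msq) (hak : 0 ≤ B1.aSeq a P.L k)
  (hΩ : ∀ x x' : HiggsLattice.Site P 0, blockIter k x = blockIter k x' → (x ∈ Ω ↔ x' ∈ Ω))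
  (hcK2 : 0 ≤ cK2) (hcK1 : 0 ≤ cK1)
  (hδ₁ : 0 < δ₁) (hδ₁1 : δ₁ ≤ 1) (hs : 0 ≤ s) (hA : ∀ b : HiggsLattice.PBond P 0, |A b| ≤ s) (hδA : 0 ≤ δA)
  (hregA : ∀ (z : HiggsLattice.Site P 0) (μ ν : Fin P.d), |A ⟨z.shift ν, μ⟩ - A ⟨z, μ⟩| ≤ δA)
  (i₀ : Ix N) (hF : ∀ i, ∀ u ∈ F i, u (ν i) = c i)
  (hexF : ∀ b ∈ exB Ω A, ∃ i : Fin nF, b.src ∈ F i) (henF : ∀ b ∈ enB Ω A, ∃ i : Fin nF, b.tgt ∈ F i)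
  (hx₁ : x₁ ∈ Ω) (hx₁' : x₁.shift μ ∈ Ω) (hx₂ : x₂ ∈ Ω) (hx₂' : x₂.shift μ ∈ Ω)
  (hα0 : 0 ≤ α) (hα1 : α < 1) (hcH : 0 ≤ cH) (hq : 0 ≤ q) (hθ : 0 < θ)
  (hH : ∀ y ∈ Ω, ∑ i : Ix N, ‖holT C B x₁ x₂ Γ μ (propagatorK C Ω B msq a k (cb P N 0 (y, i)))‖
    ≤ q * (maj P k cH (1 - α) δ₁ x₁ y + maj P k cH (1 - α) δ₁ x₂ y))
  (hh₁ : ∀ i, θ * (P.L : ℝ) ^ k ≤ ((min (x₁ (ν i) - c i).val (c i - x₁ (ν i)).val : ℕ) : ℝ))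
  (hh₂ : ∀ i, θ * (P.L : ℝ) ^ k ≤ ((min (x₂ (ν i) - c i).val (c i - x₂ (ν i)).val : ℕ) : ℝ))
include hL hk hkK hmsq hak hΩ hcK2 hcK1 hδ₁ hδ₁1 hs hA hδA hregA i₀ hF hexF henF hx₁ hx₁' hx₂ hx₂' hα0 hα1 hcH hq hθ hH hh₁ hh₂

/-- **THE HÖLDER ROW OF `G_k(Ω,B)V_k^Ω` OVER A FAMILY OF INNER FIELDS IN THE BOX STATE `J`** (the engine, inner field abstracted — used at
`w_{i′} = (1.16)^Ω_{n,n′}e_{(x′,i′)}` below and at the pure-`B` chain by the `n = 0` corner): if every `w_{i′}` is in `BoxState(J)` centred at `x′`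
(support in `Ω`, values `𝔪_k(cv_J,2+J;δ_J)(·,x′)`, derivative at bonds `⊂ Ω` regular part + pending sheet), then for `d < 1 + (J+1) − α`
`ε^{−d}Σ_{i′}‖holT(G_k(Ω,B)V_k^Ω w_{i′})‖ ≤ q·holCBθ(J)·(L^kε)^{J+1}·((L^kε)((L^kε)^d)^{−1}((L^kε)^α)^{−1})·e^{−δ_{J+1}min(|x₁−x′|,|x₂−x′|)/L^k}`.
[cite: Balaban1983Higgs3, (1.16) p.414, (2.5) p.424, (2.11) p.426, p.433] [cite: Balaban1982Higgs1, Prop. 2.1 (2.24) p.610, (3.16) p.615] -/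
theorem holder_row_boxState_le (J : ℕ) (hd : (P.d : ℝ) < 1 + ((J + 1 : ℕ) : ℝ) - α) (x' : HiggsLattice.Site P 0)
    (W : Ix N → ScalarField P 0 N)
    (hW : ∀ i' : Ix N, BoxState C Ω B k F cK1 x' (2 + (J : ℝ)) (rateB P N C k nF a cK2 cK1 s δA δ₁ cK2 cK1 J)
      (cvB P N C k nF a cK2 cK1 s δA δ₁ cK2 cK1 J) (cdB P N C k nF a cK2 cK1 s δA δ₁ cK2 cK1 J) (cSB P N C k nF a cK2 cK1 s δA δ₁ cK2 cK1 J)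
      (W i')) :
    (P.mesh 0 ^ P.d)⁻¹ * ∑ i' : Ix N, ‖holT C B x₁ x₂ Γ μ (propagatorK C Ω B msq a k (srcV C A B k Ω a (W i')))‖
      ≤ q * (holCBθ P N C k nF a cK2 cK1 s δA δ₁ α cH θ J * P.mesh k ^ (J + 1) * (P.mesh k * (P.mesh k ^ P.d)⁻¹ * (P.mesh k ^ α)⁻¹)) *
          Real.exp (-(rateB P N C k nF a cK2 cK1 s δA δ₁ cK2 cK1 (J + 1) *
            (min (HiggsLattice.Site.tdist x₁ x' : ℝ) (HiggsLattice.Site.tdist x₂ x' : ℝ) / (P.L : ℝ) ^ k))) := by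
  have hL1 : (1 : ℝ) < (P.L : ℝ) := by exact_mod_cast hL
  obtain ⟨hr0, hrδ, hcv0, hcd0, hcS0⟩ := seqB_pos (P := P) (N := N) (C := C) (k := k) (nF := nF) (a := a) (cK2 := cK2) (cK1 := cK1)
    (s := s) (δA := δA) (δ₀ := δ₁) (cv₀ := cK2) (cd₀ := cK1) hL hδ₁ le_rfl hcK2 hcK1 hcK2 hcK1 hs hδA J
  have hes : 0 ≤ |C.e| * s := mul_nonneg (abs_nonneg _) hs
  have hκ₂ : 0 ≤ (P.mesh 0)⁻¹ * (|C.e| * δA) := mul_nonneg (inv_nonneg.mpr (P.mesh_pos 0).le) (mul_nonneg (abs_nonneg _) hδA)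
  have hκ₄ : 0 ≤ kap4 P C k a s := kap4_nonneg hs
  have hκF : 0 ≤ kapF P C s δA := kapF_nonneg hs hδA
  have haK : 0 < 1 - α := by linarith
  have haK1 : 1 - α ≤ 1 := by linarith
  have hε : 0 ≤ (P.mesh 0 ^ P.d)⁻¹ := inv_nonneg.mpr (pow_nonneg (P.mesh_pos 0).le _)
  -- abbreviations for the state `J`
  set δJ := rateB P N C k nF a cK2 cK1 s δA δ₁ cK2 cK1 J with hδJ
  set cv := cvB P N C k nF a cK2 cK1 s δA δ₁ cK2 cK1 J with hcv
  set cd := cdB P N C k nF a cK2 cK1 s δA δ₁ cK2 cK1 J with hcd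
  set cS := cSB P N C k nF a cK2 cK1 s δA δ₁ cK2 cK1 J with hcS
  have hδJ1 : δJ ≤ 1 := hrδ.trans hδ₁1
  have hsJ : (1 : ℝ) < 2 + (J : ℝ) := by have := (Nat.cast_nonneg J : (0:ℝ) ≤ J); linarith
  -- the two one-anchor majorants of the Hölder column at the rate of the state
  set M₁ : HiggsLattice.Site P 0 → ℝ := fun y => maj P k cH (1 - α) δJ x₁ y with hM₁
  set M₂ : HiggsLattice.Site P 0 → ℝ := fun y => maj P k cH (1 - α) δJ x₂ y with hM₂
  set G : ScalarField P 0 N →ₗ[ℝ] ScalarField P 0 N := propagatorK C Ω B msq a k with hG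
  set T : ScalarField P 0 N →ₗ[ℝ] E N := holT C B x₁ x₂ Γ μ ∘ₗ G with hT
  have hT' : ∀ φ : ScalarField P 0 N, T φ = holT C B x₁ x₂ Γ μ (G φ) := fun φ => rfl
  have hTk : ∀ z : HiggsLattice.Site P 0, z ∉ Ω → ∀ v : E N, T (Pi.single z v) = 0 := fun z hz v =>
    holT_propagatorK_single_eq_zero C Ω B a hmsq hak hΩ B hx₁ hx₁' hx₂ hx₂' Γ hz v
  set K : HiggsLattice.Site P 0 → ℝ := fun y => ∑ i : Ix N, ‖T (cb P N 0 (y, i))‖ with hK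
  have hKle : ∀ y, K y ≤ q * (M₁ y + M₂ y) := by
    intro y
    by_cases hy : y ∈ Ω
    · refine (hH y hy).trans (mul_le_mul_of_nonneg_left (add_le_add (maj_rate_mono hcH hrδ x₁ y) (maj_rate_mono hcH hrδ x₂ y)) hq)
    · have h0 : K y = 0 := Finset.sum_eq_zero fun i _ => by rw [cb_eq_single, hTk y hy, norm_zero]
      rw [h0]
      exact mul_nonneg hq (add_nonneg (maj_nonneg hcH _ _) (maj_nonneg hcH _ _))
  -- the constants of the regular part and of the end sheet
  set cR := stepBoxC P N k nF δJ (1 - α) (2 + (J : ℝ)) cH cv cd cS cK1 (|C.e| * s) ((P.mesh 0)⁻¹ * (|C.e| * δA)) ((|C.e| * s) ^ 2)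
    (kap4 P C k a s) with hcR
  set cF := sheetHolC P δJ θ α (2 + (J : ℝ)) cH cv with hcF
  have hcF0 : 0 ≤ cF := sheetHolC_nonneg hL hr0 hθ hsJ hcH hcv0
  set e : ℝ := (1 - α) + (2 + (J : ℝ)) - 1 with he
  set δ' := δJ / 2 / P.L / 2 with hδ'
  have hδ'0 : 0 < δ' := by rw [hδ']; positivity
  have hδ'2 : δ' ≤ δJ / 2 := by
    rw [hδ', div_div, div_le_iff₀ (by positivity)]; nlinarith
  -- the per-`i′` bound: `q·Σ_p maj(cR + κ_F n_F cF, e, δ')(x_p, x′)`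
  have hpt : ∀ i' : Ix N, ‖holT C B x₁ x₂ Γ μ (G (srcV C A B k Ω a (W i')))‖
        ≤ q * (maj P k (cR + kapF P C s δA * (nF : ℝ) * cF) e δ' x₁ x' + maj P k (cR + kapF P C s δA * (nF : ℝ) * cF) e δ' x₂ x') := by
    intro i'
    set w := W i' with hw
    obtain ⟨hsupp, hV, S, hS, hD⟩ := hW i'
    rw [← hT']
    -- the derivative majorant of the state as `Df`
    set Df : HiggsLattice.PBond P 0 → ℝ := fun b =>
      maj P k cd (2 + (J : ℝ) - 1) δJ b.src x' + ∑ i : Fin nF, ∑ u ∈ F i, maj P k cK1 1 δJ b.src u * S u with hDf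
    have hDf0 : ∀ b, 0 ≤ Df b := fun b => add_nonneg (maj_nonneg hcd0 _ _)
      (Finset.sum_nonneg fun i _ => Finset.sum_nonneg fun u _ => mul_nonneg (maj_nonneg hcK1 _ _) (hS u).1)
    have hDfin : ∀ b ∈ inB Ω A, ‖covDeriv C B w b‖ ≤ Df b := fun b hb => hD b (mem_inB.1 hb).1
    have hred := collar_row_reduce C Ω A B a hkK T hs hδA hA hregA hTk w hsupp Df hDf0 hDfin F hexF henF
    -- the bulk + averaging part: split the kernel, one step per anchor
    have hsplit := row_le_of_kernel_le_add (k := k) hes hκ₂ (sq_nonneg (|C.e| * s)) hκ₄ K M₁ M₂ hKle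
      (fun y => ‖w y‖) (fun y => norm_nonneg _) Df hDf0
    have hstep : ∀ p : HiggsLattice.Site P 0,
        (∑ b : HiggsLattice.PBond P 0, (|C.e| * s * Df b * maj P k cH (1 - α) δJ p b.tgt
            + ((P.mesh 0)⁻¹ * (|C.e| * δA) * ‖w b.src‖ + |C.e| * s * Df b) * maj P k cH (1 - α) δJ p b.src
            + (|C.e| * s) ^ 2 * ‖w b.tgt‖ * maj P k cH (1 - α) δJ p b.tgt))
          + kap4 P C k a s * ∑ z : HiggsLattice.Site P 0, maj P k cH (1 - α) δJ p z *
              (((P.L : ℝ) ^ (k * P.d))⁻¹ * ∑ u ∈ blockK k (blockIter k z), ‖w u‖)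
          ≤ maj P k cR e δ' p x' := by
      intro p
      rcases Nat.eq_zero_or_pos J with hJ0 | hJpos
      · -- no sheet at `J = 0`
        have hS00 : cS = 0 := by rw [hcS, hJ0]; rfl
        have hSf0 : ∀ u, S u = 0 := fun u => by
          have h := (hS u).2
          have h0 : maj P k cS (2 + (J : ℝ) - 1) δJ u x' = 0 := by rw [hS00]; simp [maj]
          exact le_antisymm (h.trans h0.le) (hS u).1
        have hDf' : ∀ b, Df b ≤ maj P k cd (2 + (J : ℝ) - 1) δJ b.src x' := fun b => by
          simp only [hDf, hSf0, mul_zero, Finset.sum_const_zero, add_zero, le_refl]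
        have h := row_step_le (N := N) hL hk hkK hr0 hδJ1 haK hsJ hcH hcv0 hcd0 hes hκ₂ (sq_nonneg (|C.e| * s)) hκ₄ i₀ p x'
          (fun y => maj P k cH (1 - α) δJ p y) (fun y => maj_nonneg hcH p y) (fun y => le_rfl)
          (fun y => ‖w y‖) (fun y => norm_nonneg _) hV Df hDf0 hDf'
        refine h.trans (le_of_eq ?_)
        rw [hcR, hS00, stepBoxC_zero_sheet]
      · have hav : (2 : ℝ) < 2 + (J : ℝ) := by
          have h0J : (0 : ℝ) < (J : ℝ) := Nat.cast_pos.mpr hJpos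
          linarith
        exact row_step_box_deriv_le (N := N) hL hk hkK hr0 hδJ1 haK hav hcH hcv0 hcd0 hcS0 hcK1 hes hκ₂ (sq_nonneg (|C.e| * s)) hκ₄ i₀ p x'
          F ν c hF (fun y => maj P k cH (1 - α) δJ p y) (fun y => maj_nonneg hcH p y) (fun y => le_rfl)
          (fun y => ‖w y‖) (fun y => norm_nonneg _) hV (fun _ => S) (fun _ u _ => (hS u).1) (fun _ u _ => (hS u).2) Df (fun b => le_rfl)
    -- the end sheet at each anchor
    have hface : ∀ (p : HiggsLattice.Site P 0), (∀ i, θ * (P.L : ℝ) ^ k ≤ ((min (p (ν i) - c i).val (c i - p (ν i)).val : ℕ) : ℝ)) →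
        ∑ i : Fin nF, ∑ u ∈ F i, ‖w u‖ * maj P k cH (1 - α) δJ p u ≤ (nF : ℝ) * maj P k cF e (δJ / 2) p x' := by
      intro p hhp
      have hone : ∀ i : Fin nF, ∑ u ∈ F i, ‖w u‖ * maj P k cH (1 - α) δJ p u ≤ maj P k cF e (δJ / 2) p x' := by
        intro i
        have h := face_sum_kernel_le_one_margin_le (P := P) hL (k := k) hr0 hδJ1 haK haK1 hsJ hcH hcv0 hθ (hF i) p x' (hhp i)
          (fun u => maj P k cH (1 - α) δJ p u) (fun u => ‖w u‖) (fun u _ => maj_nonneg hcH _ _) (fun u _ => norm_nonneg _)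
          (fun u _ => le_of_eq rfl) (fun u _ => hV u)
        simp only [mul_comm (‖w _‖) (maj P k cH (1 - α) δJ p _)]
        refine h.trans (le_of_eq ?_)
        rw [hcF, he]
        unfold maj sheetHolC
        rfl
      calc ∑ i : Fin nF, ∑ u ∈ F i, ‖w u‖ * maj P k cH (1 - α) δJ p u
          ≤ ∑ _i : Fin nF, maj P k cF e (δJ / 2) p x' := Finset.sum_le_sum fun i _ => hone i
        _ = _ := by rw [Finset.sum_const, Finset.card_univ, Fintype.card_fin, nsmul_eq_mul]
    have hfaces : kapF P C s δA * ∑ i : Fin nF, ∑ u ∈ F i, ‖w u‖ * K u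
        ≤ q * (maj P k (kapF P C s δA * (nF : ℝ) * cF) e δ' x₁ x' + maj P k (kapF P C s δA * (nF : ℝ) * cF) e δ' x₂ x') := by
      have h1 : ∑ i : Fin nF, ∑ u ∈ F i, ‖w u‖ * K u
          ≤ q * (∑ i : Fin nF, ∑ u ∈ F i, ‖w u‖ * maj P k cH (1 - α) δJ x₁ u + ∑ i : Fin nF, ∑ u ∈ F i, ‖w u‖ * maj P k cH (1 - α) δJ x₂ u) := by
        rw [← Finset.sum_add_distrib, Finset.mul_sum]
        refine Finset.sum_le_sum fun i _ => ?_
        rw [← Finset.sum_add_distrib, Finset.mul_sum]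
        refine Finset.sum_le_sum fun u _ => ?_
        have := mul_le_mul_of_nonneg_left (hKle u) (norm_nonneg (w u))
        refine this.trans (le_of_eq ?_)
        simp only [hM₁, hM₂]; ring
      have h2 := add_le_add (hface x₁ hh₁) (hface x₂ hh₂)
      have hmono : ∀ p : HiggsLattice.Site P 0, maj P k cF e (δJ / 2) p x' ≤ maj P k cF e δ' p x' := fun p => maj_rate_mono hcF0 hδ'2 p x'
      calc kapF P C s δA * ∑ i : Fin nF, ∑ u ∈ F i, ‖w u‖ * K u
          ≤ kapF P C s δA * (q * ((nF : ℝ) * maj P k cF e (δJ / 2) x₁ x' + (nF : ℝ) * maj P k cF e (δJ / 2) x₂ x')) :=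
            mul_le_mul_of_nonneg_left (h1.trans (mul_le_mul_of_nonneg_left h2 hq)) hκF
        _ ≤ kapF P C s δA * (q * ((nF : ℝ) * maj P k cF e δ' x₁ x' + (nF : ℝ) * maj P k cF e δ' x₂ x')) :=
            mul_le_mul_of_nonneg_left (mul_le_mul_of_nonneg_left (add_le_add (mul_le_mul_of_nonneg_left (hmono x₁) (Nat.cast_nonneg _))
              (mul_le_mul_of_nonneg_left (hmono x₂) (Nat.cast_nonneg _))) hq) hκF
        _ = _ := by rw [← mul_maj, ← mul_maj]; ring
    -- assemble the per-`i′` bound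
    refine hred.trans ?_
    have hrow := hsplit.trans (mul_le_mul_of_nonneg_left (add_le_add (hstep x₁) (hstep x₂)) hq)
    refine (add_le_add hrow hfaces).trans (le_of_eq ?_)
    rw [← maj_add, ← maj_add]; ring
  -- top-scale domination and the two anchors
  have hcR0 : 0 ≤ cR := by
    rcases Nat.eq_zero_or_pos J with hJ0 | hJpos
    · have hS00 : cS = 0 := by rw [hcS, hJ0]; rfl
      rw [hcR, hS00, stepBoxC_zero_sheet]
      exact stepC_nonneg hL k hr0 haK hsJ hcH hcv0 hcd0 hes hκ₂ (sq_nonneg _) hκ₄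
    · have hav : (2 : ℝ) < 2 + (J : ℝ) := by
        have h0J : (0 : ℝ) < (J : ℝ) := Nat.cast_pos.mpr hJpos
        linarith
      exact stepBoxC_nonneg hL k nF hr0 haK hav hcH hcv0 hcd0 hcS0 hcK1 hes hκ₂ (sq_nonneg _) hκ₄
  set cT := cR + kapF P C s δA * (nF : ℝ) * cF with hcT
  have hcT0 : 0 ≤ cT := by rw [hcT]; positivity
  have hsM : 0 < e - (P.d : ℝ) := by rw [he]; push_cast at hd ⊢; linarith
  have hexp : e - (P.d : ℝ) = (1 : ℝ) + ((J + 1 : ℕ) : ℝ) - α - (P.d : ℝ) := by rw [he]; push_cast; ring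
  have htop : ∀ p : HiggsLattice.Site P 0, maj P k cT e δ' p x'
      ≤ cT / ((P.L : ℝ) ^ (e - (P.d : ℝ)) - 1) * P.mesh k ^ (e - (P.d : ℝ)) *
          Real.exp (-(δ' * (P.mesh k)⁻¹ * (P.mesh 0 * (HiggsLattice.Site.tdist p x' : ℝ)))) := by
    intro p
    unfold maj
    exact majorant_le_top hL hcT0 hsM hδ'0.le p x'
  set Z : ℝ := cT / ((P.L : ℝ) ^ ((1 : ℝ) + ((J + 1 : ℕ) : ℝ) - α - (P.d : ℝ)) - 1) *
    (P.mesh k ^ (J + 1) * (P.mesh k * (P.mesh k ^ P.d)⁻¹ * (P.mesh k ^ α)⁻¹)) with hZ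
  have hgeom : 0 < (P.L : ℝ) ^ ((1 : ℝ) + ((J + 1 : ℕ) : ℝ) - α - (P.d : ℝ)) - 1 := by
    have : (1 : ℝ) < (P.L : ℝ) ^ ((1 : ℝ) + ((J + 1 : ℕ) : ℝ) - α - (P.d : ℝ)) := Real.one_lt_rpow hL1 (by rw [← hexp]; exact hsM)
    linarith
  have hZ0 : 0 ≤ Z := by have := P.mesh_pos k; rw [hZ]; positivity
  have htop' : ∀ p : HiggsLattice.Site P 0, maj P k cT e δ' p x' ≤ Z * Real.exp (-(δ' * ((HiggsLattice.Site.tdist p x' : ℝ) / (P.L : ℝ) ^ k))) := by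
    intro p
    refine (htop p).trans (le_of_eq ?_)
    rw [hexp, mesh_rpow_split_holder, rate_div_eq, hZ]
  have hLk : (0 : ℝ) < (P.L : ℝ) ^ k := by positivity
  have hsum2 := exp_add_exp_le_two_exp_min hδ'0.le hLk (HiggsLattice.Site.tdist x₁ x' : ℝ) (HiggsLattice.Site.tdist x₂ x' : ℝ)
  have hδ'eq : rateB P N C k nF a cK2 cK1 s δA δ₁ cK2 cK1 (J + 1) = δ' := by
    rw [hδ', hδJ]
    exact (seqB_succ (P := P) (N := N) (C := C) (k := k) (nF := nF) (a := a) (cK2 := cK2) (cK1 := cK1) (s := s) (δA := δA) (δ₀ := δ₁)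
      (cv₀ := cK2) (cd₀ := cK1) J).1
  calc (P.mesh 0 ^ P.d)⁻¹ * ∑ i' : Ix N, ‖holT C B x₁ x₂ Γ μ (G (srcV C A B k Ω a (W i')))‖
      ≤ (P.mesh 0 ^ P.d)⁻¹ * ∑ _i' : Ix N, q * (Z * Real.exp (-(δ' * ((HiggsLattice.Site.tdist x₁ x' : ℝ) / (P.L : ℝ) ^ k)))
          + Z * Real.exp (-(δ' * ((HiggsLattice.Site.tdist x₂ x' : ℝ) / (P.L : ℝ) ^ k)))) := by
        refine mul_le_mul_of_nonneg_left (Finset.sum_le_sum fun i' _ => (hpt i').trans ?_) hε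
        exact mul_le_mul_of_nonneg_left (add_le_add (htop' x₁) (htop' x₂)) hq
    _ = q * ((P.mesh 0 ^ P.d)⁻¹ * (Fintype.card (Ix N) : ℝ) * Z) *
          (Real.exp (-(δ' * ((HiggsLattice.Site.tdist x₁ x' : ℝ) / (P.L : ℝ) ^ k)))
            + Real.exp (-(δ' * ((HiggsLattice.Site.tdist x₂ x' : ℝ) / (P.L : ℝ) ^ k)))) := by
        rw [Finset.sum_const, Finset.card_univ, nsmul_eq_mul]; ring
    _ ≤ q * ((P.mesh 0 ^ P.d)⁻¹ * (Fintype.card (Ix N) : ℝ) * Z) *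
          (2 * Real.exp (-(δ' * (min (HiggsLattice.Site.tdist x₁ x' : ℝ) (HiggsLattice.Site.tdist x₂ x' : ℝ) / (P.L : ℝ) ^ k)))) :=
        mul_le_mul_of_nonneg_left hsum2 (by positivity)
    _ = _ := by
        rw [hδ'eq, holCBθ, hZ, hcT, hcR, hcF]
        ring


end Row

/-! ## §3 The Hölder quotient of the row derivative of the kernel of (1.16) on `Ω`, at bonds one top block inside the faces -/

section Holder

variable {C : ChargeData N} {Ω : Finset (HiggsLattice.Site P 0)} {A B : HiggsLattice.VecField P 0} {msq a : ℝ} {k : ℕ}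
  {δ₁ s δA cK2 cK1 α cH q θ : ℝ} {nF : ℕ} {F : Fin nF → Finset (HiggsLattice.Site P 0)} {ν : Fin nF → Fin P.d}
  {c : (i : Fin nF) → ZMod (P.sitesPerDir 0 (ν i))} {x₁ x₂ x' : HiggsLattice.Site P 0} {μ : Fin P.d} {Γ : List (HiggsLattice.Site P 0)}

variable (hL : 1 < P.L) (hk : 1 ≤ k) (hkK : k ≤ P.K) (hmsq : 0 < msq) (hak : 0 ≤ B1.aSeq a P.L k)
  (hΩ : ∀ x x' : HiggsLattice.Site P 0, blockIter k x = blockIter k x' → (x ∈ Ω ↔ x' ∈ Ω))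
  (hcK2 : 0 ≤ cK2) (hcK1 : 0 ≤ cK1)
  (hcolB : ∀ x ∈ Ω, ∀ z ∈ Ω, ∑ i : Ix N, ‖propagatorK C Ω B msq a k (cb P N 0 (z, i)) x‖ ≤ maj P k cK2 2 δ₁ x z)
  (hdcolB : ∀ b : HiggsLattice.PBond P 0, Inside Ω b → ∀ z ∈ Ω,
    ∑ i : Ix N, ‖covDeriv C B (propagatorK C Ω B msq a k (cb P N 0 (z, i))) b‖ ≤ maj P k cK1 1 δ₁ b.src z)
  (hcolAB : ∀ x ∈ Ω, ∀ z ∈ Ω, ∑ i : Ix N, ‖propagatorK C Ω (A + B) msq a k (cb P N 0 (z, i)) x‖ ≤ maj P k cK2 2 δ₁ x z)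
  (hdcolAB : ∀ b : HiggsLattice.PBond P 0, Inside Ω b → ∀ z ∈ Ω,
    ∑ i : Ix N, ‖covDeriv C B (propagatorK C Ω (A + B) msq a k (cb P N 0 (z, i))) b‖ ≤ maj P k cK1 1 δ₁ b.src z)
  (hδ₁ : 0 < δ₁) (hδ₁1 : δ₁ ≤ 1) (hs : 0 ≤ s) (hA : ∀ b : HiggsLattice.PBond P 0, |A b| ≤ s) (hδA : 0 ≤ δA)
  (hregA : ∀ (z : HiggsLattice.Site P 0) (μ ν : Fin P.d), |A ⟨z.shift ν, μ⟩ - A ⟨z, μ⟩| ≤ δA)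
  (i₀ : Ix N) (hF : ∀ i, ∀ u ∈ F i, u (ν i) = c i)
  (hexF : ∀ b ∈ exB Ω A, ∃ i : Fin nF, b.src ∈ F i) (henF : ∀ b ∈ enB Ω A, ∃ i : Fin nF, b.tgt ∈ F i)
  (hx' : x' ∈ Ω) (hx₁ : x₁ ∈ Ω) (hx₁' : x₁.shift μ ∈ Ω) (hx₂ : x₂ ∈ Ω) (hx₂' : x₂.shift μ ∈ Ω)
  (hα0 : 0 ≤ α) (hα1 : α < 1) (hcH : 0 ≤ cH) (hq : 0 ≤ q) (hθ : 0 < θ)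
  (hH : ∀ y ∈ Ω, ∑ i : Ix N, ‖holT C B x₁ x₂ Γ μ (propagatorK C Ω B msq a k (cb P N 0 (y, i)))‖
    ≤ q * (maj P k cH (1 - α) δ₁ x₁ y + maj P k cH (1 - α) δ₁ x₂ y))
  (hh₁ : ∀ i, θ * (P.L : ℝ) ^ k ≤ ((min (x₁ (ν i) - c i).val (c i - x₁ (ν i)).val : ℕ) : ℝ))
  (hh₂ : ∀ i, θ * (P.L : ℝ) ^ k ≤ ((min (x₂ (ν i) - c i).val (c i - x₂ (ν i)).val : ℕ) : ℝ))
include hL hk hkK hmsq hak hΩ hcK2 hcK1 hcolB hdcolB hcolAB hdcolAB hδ₁ hδ₁1 hs hA hδA hregA i₀ hF hexF henF hx' hx₁ hx₁' hx₂ hx₂' hα0 hα1 hcH hq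
  hθ hH hh₁ hh₂

/-- **THE HÖLDER QUOTIENT OF THE ROW DERIVATIVE OF THE KERNEL OF (1.16) ON `Ω` AT BONDS ONE TOP BLOCK INSIDE THE FACES, FOR ALL `n ≥ 1`,
`d < n + n′ + 2 − α`** (see the module docstring for the hypotheses): for every `n, n′` with `d < 1 + (n+1+n′) − α`,
`ε^{−d}Σ_{i′}‖U(B(Γ))(D^ε_B(1.16)^Ω_{n+1,n′}e_{(x′,i′)})(⟨x₂,μ⟩) − (D^ε_B(1.16)^Ω_{n+1,n′}e_{(x′,i′)})(⟨x₁,μ⟩)‖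
  ≤ q·holCBθ(n+n′)·(L^kε)^{n+1+n′}·((L^kε)((L^kε)^d)^{−1}((L^kε)^α)^{−1})·e^{−δ_{n+1+n′}min(|x₁−x′|,|x₂−x′|)/L^k}`
— p40's binder `hH`, uniform in `k`; NO support clause on `A` (`holder_row_boxState_le` at the inner fields `(1.16)^Ω_{n,n′}e_{(x′,i′)}`, in
`BoxState(n+n′)` by `state_op116_box_cb`). [cite: Balaban1983Higgs3, (1.16) p.414, (2.5) p.424, (2.11) p.426, p.433] [cite: Balaban1982Higgs1, Prop. 2.1 (2.24) p.610, (3.16) p.615] -/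
theorem kernel116_holder_box_margin_le (n n' : ℕ) (hd : (P.d : ℝ) < 1 + ((n + 1 + n' : ℕ) : ℝ) - α) :
    (P.mesh 0 ^ P.d)⁻¹ * ∑ i' : Ix N,
        ‖hol C B x₁ Γ (covDeriv C B (op116 C Ω A B msq a k (n + 1) n' (cb P N 0 (x', i'))) ⟨x₂, μ⟩)
          - covDeriv C B (op116 C Ω A B msq a k (n + 1) n' (cb P N 0 (x', i'))) ⟨x₁, μ⟩‖
      ≤ q * (holCBθ P N C k nF a cK2 cK1 s δA δ₁ α cH θ (n + n') * P.mesh k ^ (n + 1 + n') *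
            (P.mesh k * (P.mesh k ^ P.d)⁻¹ * (P.mesh k ^ α)⁻¹)) *
          Real.exp (-(rateB P N C k nF a cK2 cK1 s δA δ₁ cK2 cK1 (n + 1 + n') *
            (min (HiggsLattice.Site.tdist x₁ x' : ℝ) (HiggsLattice.Site.tdist x₂ x' : ℝ) / (P.L : ℝ) ^ k))) := by
  have hMJ : n + 1 + n' = n + n' + 1 := by omega
  have h := holder_row_boxState_le hL hk hkK hmsq hak hΩ hcK2 hcK1 hδ₁ hδ₁1 hs hA hδA hregA i₀ hF hexF henF hx₁ hx₁' hx₂ hx₂' hα0 hα1 hcH hq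
    hθ hH hh₁ hh₂ (n + n') (by rw [← hMJ]; exact hd) x' (fun i' => op116 C Ω A B msq a k n n' (cb P N 0 (x', i')))
    (fun i' => state_op116_box_cb hL hk hkK hmsq hak hΩ hcK2 hcK1 hcolB hdcolB hcolAB hdcolAB hδ₁ hδ₁1 hs hA hδA hregA i₀ hF hexF henF hx' n n' i')
  have hsum : ∑ i' : Ix N, ‖hol C B x₁ Γ (covDeriv C B (op116 C Ω A B msq a k (n + 1) n' (cb P N 0 (x', i'))) ⟨x₂, μ⟩)
          - covDeriv C B (op116 C Ω A B msq a k (n + 1) n' (cb P N 0 (x', i'))) ⟨x₁, μ⟩‖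
      = ∑ i' : Ix N, ‖holT C B x₁ x₂ Γ μ (propagatorK C Ω B msq a k (srcV C A B k Ω a (op116 C Ω A B msq a k n n' (cb P N 0 (x', i')))))‖ :=
    Finset.sum_congr rfl fun i' _ => by rw [op116_succ_left_apply, ← holT_apply]
  rw [hsum, hMJ]
  exact h

end Holder

/-! ## §4 The pure-`B` chain `G_k(Ω,B)(V_k^ΩG_k(Ω,B))^m e_{(x′,i′)}` in the box state -/

section Chain

variable {C : ChargeData N} {Ω : Finset (HiggsLattice.Site P 0)} {A B : HiggsLattice.VecField P 0} {msq a : ℝ} {k : ℕ}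
  {δ₁ s δA cK2 cK1 : ℝ} {nF : ℕ} {F : Fin nF → Finset (HiggsLattice.Site P 0)} {ν : Fin nF → Fin P.d}
  {c : (i : Fin nF) → ZMod (P.sitesPerDir 0 (ν i))}

variable (hL : 1 < P.L) (hk : 1 ≤ k) (hkK : k ≤ P.K) (hmsq : 0 < msq) (hak : 0 ≤ B1.aSeq a P.L k)
  (hΩ : ∀ x x' : HiggsLattice.Site P 0, blockIter k x = blockIter k x' → (x ∈ Ω ↔ x' ∈ Ω))
  (hcK2 : 0 ≤ cK2) (hcK1 : 0 ≤ cK1)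
  (hcolB : ∀ x ∈ Ω, ∀ z ∈ Ω, ∑ i : Ix N, ‖propagatorK C Ω B msq a k (cb P N 0 (z, i)) x‖ ≤ maj P k cK2 2 δ₁ x z)
  (hdcolB : ∀ b : HiggsLattice.PBond P 0, Inside Ω b → ∀ z ∈ Ω,
    ∑ i : Ix N, ‖covDeriv C B (propagatorK C Ω B msq a k (cb P N 0 (z, i))) b‖ ≤ maj P k cK1 1 δ₁ b.src z)
  (hcolAB : ∀ x ∈ Ω, ∀ z ∈ Ω, ∑ i : Ix N, ‖propagatorK C Ω (A + B) msq a k (cb P N 0 (z, i)) x‖ ≤ maj P k cK2 2 δ₁ x z)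
  (hdcolAB : ∀ b : HiggsLattice.PBond P 0, Inside Ω b → ∀ z ∈ Ω,
    ∑ i : Ix N, ‖covDeriv C B (propagatorK C Ω (A + B) msq a k (cb P N 0 (z, i))) b‖ ≤ maj P k cK1 1 δ₁ b.src z)
  (hδ₁ : 0 < δ₁) (hδ₁1 : δ₁ ≤ 1) (hs : 0 ≤ s) (hA : ∀ b : HiggsLattice.PBond P 0, |A b| ≤ s) (hδA : 0 ≤ δA)
  (hregA : ∀ (z : HiggsLattice.Site P 0) (μ ν : Fin P.d), |A ⟨z.shift ν, μ⟩ - A ⟨z, μ⟩| ≤ δA)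
  (i₀ : Ix N) (hF : ∀ i, ∀ u ∈ F i, u (ν i) = c i)
  (hexF : ∀ b ∈ exB Ω A, ∃ i : Fin nF, b.src ∈ F i) (henF : ∀ b ∈ enB Ω A, ∃ i : Fin nF, b.tgt ∈ F i)
  {x' : HiggsLattice.Site P 0} (hx' : x' ∈ Ω)
include hL hk hkK hmsq hak hΩ hcK2 hcK1 hcolB hdcolB hcolAB hdcolAB hδ₁ hδ₁1 hs hA hδA hregA i₀ hF hexF henF hx'

/-- **THE PURE-`B` CHAIN IN THE BOX STATE**: `G_k(Ω,B)(V_k^ΩG_k(Ω,B))^m e_{(x′,i′)}` is in `BoxState(m)` centred at `x′ ∈ Ω` (`base_state_box` at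
`X = B`, then `step_state_box` at `X = B`, `m` times; the source map `φ ↦ V_k^ΩG_k(Ω,B)φ` as `Function.iterate`).
[cite: Balaban1983Higgs3, (1.16) p.414, (2.10) p.426, p.433] -/
theorem state_chainB_box : ∀ (m : ℕ) (i' : Ix N),
    BoxState C Ω B k F cK1 x' (2 + (m : ℝ)) (rateB P N C k nF a cK2 cK1 s δA δ₁ cK2 cK1 m) (cvB P N C k nF a cK2 cK1 s δA δ₁ cK2 cK1 m)
      (cdB P N C k nF a cK2 cK1 s δA δ₁ cK2 cK1 m) (cSB P N C k nF a cK2 cK1 s δA δ₁ cK2 cK1 m)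
      (propagatorK C Ω B msq a k ((fun ψ => srcV C A B k Ω a (propagatorK C Ω B msq a k ψ))^[m] (cb P N 0 (x', i')))) := by
  intro m
  induction m with
  | zero =>
    intro i'
    simp only [Function.iterate_zero, id_eq]
    exact base_state_box hmsq hak hΩ hcK2 hcolB hdcolB hcolAB hdcolAB hx' i' B (Or.inl rfl)
  | succ m ih =>
    intro i'
    rw [Function.iterate_succ_apply']
    exact step_state_box hL hk hkK hmsq hak hΩ hcK2 hcK1 hcolB hdcolB hcolAB hdcolAB hδ₁1 hs hA hδA hregA i₀ hF hexF henF hδ₁ le_rfl hcK2 hcK1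
      x' m _ (ih i') B (Or.inl rfl)

end Chain

/-! ## §5 The `n = 0` Hölder member on `Ω`, anchors one top block inside the faces -/

section Zero

variable {C : ChargeData N} {Ω : Finset (HiggsLattice.Site P 0)} {A B : HiggsLattice.VecField P 0} {msq a : ℝ} {k : ℕ}
  {δ₁ s δA cK2 cK1 α cH q θ : ℝ} {nF : ℕ} {F : Fin nF → Finset (HiggsLattice.Site P 0)} {ν : Fin nF → Fin P.d}
  {c : (i : Fin nF) → ZMod (P.sitesPerDir 0 (ν i))} {x₁ x₂ x' : HiggsLattice.Site P 0} {μ : Fin P.d} {Γ : List (HiggsLattice.Site P 0)}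

variable (hL : 1 < P.L) (hk : 1 ≤ k) (hkK : k ≤ P.K) (hmsq : 0 < msq) (ha : 0 < a) (hak : 0 ≤ B1.aSeq a P.L k)
  (hΩ : ∀ x x' : HiggsLattice.Site P 0, blockIter k x = blockIter k x' → (x ∈ Ω ↔ x' ∈ Ω))
  (hcK2 : 0 ≤ cK2) (hcK1 : 0 ≤ cK1)
  (hcolB : ∀ x ∈ Ω, ∀ z ∈ Ω, ∑ i : Ix N, ‖propagatorK C Ω B msq a k (cb P N 0 (z, i)) x‖ ≤ maj P k cK2 2 δ₁ x z)
  (hdcolB : ∀ b : HiggsLattice.PBond P 0, Inside Ω b → ∀ z ∈ Ω,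
    ∑ i : Ix N, ‖covDeriv C B (propagatorK C Ω B msq a k (cb P N 0 (z, i))) b‖ ≤ maj P k cK1 1 δ₁ b.src z)
  (hcolAB : ∀ x ∈ Ω, ∀ z ∈ Ω, ∑ i : Ix N, ‖propagatorK C Ω (A + B) msq a k (cb P N 0 (z, i)) x‖ ≤ maj P k cK2 2 δ₁ x z)
  (hdcolAB : ∀ b : HiggsLattice.PBond P 0, Inside Ω b → ∀ z ∈ Ω,
    ∑ i : Ix N, ‖covDeriv C B (propagatorK C Ω (A + B) msq a k (cb P N 0 (z, i))) b‖ ≤ maj P k cK1 1 δ₁ b.src z)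
  (hδ₁ : 0 < δ₁) (hδ₁1 : δ₁ ≤ 1) (hs : 0 ≤ s) (hA : ∀ b : HiggsLattice.PBond P 0, |A b| ≤ s) (hδA : 0 ≤ δA)
  (hregA : ∀ (z : HiggsLattice.Site P 0) (μ ν : Fin P.d), |A ⟨z.shift ν, μ⟩ - A ⟨z, μ⟩| ≤ δA)
  (i₀ : Ix N) (hF : ∀ i, ∀ u ∈ F i, u (ν i) = c i)
  (hexF : ∀ b ∈ exB Ω A, ∃ i : Fin nF, b.src ∈ F i) (henF : ∀ b ∈ enB Ω A, ∃ i : Fin nF, b.tgt ∈ F i)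
  (hx' : x' ∈ Ω) (hx₁ : x₁ ∈ Ω) (hx₁' : x₁.shift μ ∈ Ω) (hx₂ : x₂ ∈ Ω) (hx₂' : x₂.shift μ ∈ Ω)
  (hα0 : 0 ≤ α) (hα1 : α < 1) (hcH : 0 ≤ cH) (hq : 0 ≤ q) (hθ : 0 < θ)
  (hH : ∀ y ∈ Ω, ∑ i : Ix N, ‖holT C B x₁ x₂ Γ μ (propagatorK C Ω B msq a k (cb P N 0 (y, i)))‖
    ≤ q * (maj P k cH (1 - α) δ₁ x₁ y + maj P k cH (1 - α) δ₁ x₂ y))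
  (hh₁ : ∀ i, θ * (P.L : ℝ) ^ k ≤ ((min (x₁ (ν i) - c i).val (c i - x₁ (ν i)).val : ℕ) : ℝ))
  (hh₂ : ∀ i, θ * (P.L : ℝ) ^ k ≤ ((min (x₂ (ν i) - c i).val (c i - x₂ (ν i)).val : ℕ) : ℝ))
include hL hk hkK hmsq ha hak hΩ hcK2 hcK1 hcolB hdcolB hcolAB hdcolAB hδ₁ hδ₁1 hs hA hδA hregA i₀ hF hexF henF hx' hx₁ hx₁' hx₂ hx₂' hα0 hα1 hcH
  hq hθ hH hh₁ hh₂

/-- **THE `n = 0` HÖLDER MEMBER ON `Ω`** (outer factor `G_k(Ω,Ã+B̃)`; anchors one top block inside the faces): for every `n′` with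
`d < 1 + (n′+1) − α`,
`ε^{−d}Σ_{i′}‖U(B(Γ))(D^ε_B(1.16)^Ω_{0,n′+1}e_{(x′,i′)})(⟨x₂,μ⟩) − (D^ε_B(1.16)^Ω_{0,n′+1}e_{(x′,i′)})(⟨x₁,μ⟩)‖
  ≤ q·(holCBθ(n′)(L^kε)^{n′+1} + holCBθ(n′+1)(L^kε)^{n′+2})·((L^kε)((L^kε)^d)^{−1}((L^kε)^α)^{−1})·e^{−δ_{n′+2}min(|x₁−x′|,|x₂−x′|)/L^k}`
((I.3.44) split; the chain term by `holder_row_boxState_le` at `state_chainB_box n′`, the `(1, n′+1)` term by `kernel116_holder_box_margin_le`).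
[cite: Balaban1983Higgs3, (1.16) p.414, (2.5) p.424, (2.11) p.426, p.433] [cite: Balaban1982Higgs1, (3.44) p.619, Prop. 2.1 (2.24) p.610] -/
theorem kernel116_holder_box_zero_left_margin_le (n' : ℕ) (hd : (P.d : ℝ) < 1 + ((n' + 1 : ℕ) : ℝ) - α) :
    (P.mesh 0 ^ P.d)⁻¹ * ∑ i' : Ix N,
        ‖hol C B x₁ Γ (covDeriv C B (op116 C Ω A B msq a k 0 (n' + 1) (cb P N 0 (x', i'))) ⟨x₂, μ⟩)
          - covDeriv C B (op116 C Ω A B msq a k 0 (n' + 1) (cb P N 0 (x', i'))) ⟨x₁, μ⟩‖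
      ≤ q * ((holCBθ P N C k nF a cK2 cK1 s δA δ₁ α cH θ n' * P.mesh k ^ (n' + 1)
              + holCBθ P N C k nF a cK2 cK1 s δA δ₁ α cH θ (n' + 1) * P.mesh k ^ (n' + 2)) *
            (P.mesh k * (P.mesh k ^ P.d)⁻¹ * (P.mesh k ^ α)⁻¹)) *
          Real.exp (-(rateB P N C k nF a cK2 cK1 s δA δ₁ cK2 cK1 (n' + 2) *
            (min (HiggsLattice.Site.tdist x₁ x' : ℝ) (HiggsLattice.Site.tdist x₂ x' : ℝ) / (P.L : ℝ) ^ k))) := by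
  have hL1 : (1 : ℝ) < (P.L : ℝ) := by exact_mod_cast hL
  set f : ScalarField P 0 N → ScalarField P 0 N := fun ψ => srcV C A B k Ω a (propagatorK C Ω B msq a k ψ) with hf
  set X : ℝ := P.mesh k * (P.mesh k ^ P.d)⁻¹ * (P.mesh k ^ α)⁻¹ with hX
  set m : ℝ := min (HiggsLattice.Site.tdist x₁ x' : ℝ) (HiggsLattice.Site.tdist x₂ x' : ℝ) / (P.L : ℝ) ^ k with hm
  have hX0 : 0 ≤ X := by have := P.mesh_pos k; rw [hX]; positivity
  have hm0 : 0 ≤ m := by rw [hm]; positivity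
  -- the chain term: the engine at the pure-`B` chain, state `n′`
  have h1 := holder_row_boxState_le hL hk hkK hmsq hak hΩ hcK2 hcK1 hδ₁ hδ₁1 hs hA hδA hregA i₀ hF hexF henF hx₁ hx₁' hx₂ hx₂' hα0 hα1 hcH hq
    hθ hH hh₁ hh₂ n' hd x' (fun i' => propagatorK C Ω B msq a k (f^[n'] (cb P N 0 (x', i'))))
    (fun i' => state_chainB_box hL hk hkK hmsq hak hΩ hcK2 hcK1 hcolB hdcolB hcolAB hdcolAB hδ₁ hδ₁1 hs hA hδA hregA i₀ hF hexF henF hx' n' i')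
  -- the `(1, n′+1)` term
  have hd2 : (P.d : ℝ) < 1 + ((0 + 1 + (n' + 1) : ℕ) : ℝ) - α := by push_cast at hd ⊢; linarith
  have h2 := kernel116_holder_box_margin_le hL hk hkK hmsq hak hΩ hcK2 hcK1 hcolB hdcolB hcolAB hdcolAB hδ₁ hδ₁1 hs hA hδA hregA i₀ hF hexF
    henF hx' hx₁ hx₁' hx₂ hx₂' hα0 hα1 hcH hq hθ hH hh₁ hh₂ 0 (n' + 1) hd2
  have e1 : 0 + 1 + (n' + 1) = n' + 2 := by omega
  have e2 : 0 + (n' + 1) = n' + 1 := by omega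
  rw [e1, e2] at h2
  -- the split, pointwise
  have hpt : ∀ i' : Ix N,
      ‖hol C B x₁ Γ (covDeriv C B (op116 C Ω A B msq a k 0 (n' + 1) (cb P N 0 (x', i'))) ⟨x₂, μ⟩)
          - covDeriv C B (op116 C Ω A B msq a k 0 (n' + 1) (cb P N 0 (x', i'))) ⟨x₁, μ⟩‖
        ≤ ‖holT C B x₁ x₂ Γ μ (propagatorK C Ω B msq a k (srcV C A B k Ω a (propagatorK C Ω B msq a k (f^[n'] (cb P N 0 (x', i'))))))‖
          + ‖hol C B x₁ Γ (covDeriv C B (op116 C Ω A B msq a k 1 (n' + 1) (cb P N 0 (x', i'))) ⟨x₂, μ⟩)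
              - covDeriv C B (op116 C Ω A B msq a k 1 (n' + 1) (cb P N 0 (x', i'))) ⟨x₁, μ⟩‖ := by
    intro i'
    rw [← holT_apply, ← holT_apply, op116_zero_succ_split_region hL hmsq ha hk n' (cb P N 0 (x', i')), map_add]
    exact norm_add_le _ _
  -- the rates: `δ_{n′+2} ≤ δ_{n′+1}`
  obtain ⟨hr0, -, -, -, -⟩ := seqB_pos (P := P) (N := N) (C := C) (k := k) (nF := nF) (a := a) (cK2 := cK2) (cK1 := cK1) (s := s) (δA := δA)
    (δ₀ := δ₁) (cv₀ := cK2) (cd₀ := cK1) hL hδ₁ le_rfl hcK2 hcK1 hcK2 hcK1 hs hδA (n' + 1)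
  have hrate : rateB P N C k nF a cK2 cK1 s δA δ₁ cK2 cK1 (n' + 2) ≤ rateB P N C k nF a cK2 cK1 s δA δ₁ cK2 cK1 (n' + 1) := by
    rw [show n' + 2 = n' + 1 + 1 by omega, (seqB_succ (P := P) (N := N) (C := C) (k := k) (nF := nF) (a := a) (cK2 := cK2) (cK1 := cK1)
      (s := s) (δA := δA) (δ₀ := δ₁) (cv₀ := cK2) (cd₀ := cK1) (n' + 1)).1, div_div, div_div]
    exact div_le_self hr0.le (by linarith)
  have hexp : Real.exp (-(rateB P N C k nF a cK2 cK1 s δA δ₁ cK2 cK1 (n' + 1) * m))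
      ≤ Real.exp (-(rateB P N C k nF a cK2 cK1 s δA δ₁ cK2 cK1 (n' + 2) * m)) :=
    Real.exp_le_exp.mpr (by nlinarith)
  have hB1 : 0 ≤ q * (holCBθ P N C k nF a cK2 cK1 s δA δ₁ α cH θ n' * P.mesh k ^ (n' + 1) * X) := by
    have h0 := holCBθ_nonneg (P := P) (N := N) hL (C := C) k nF (a := a) hδ₁ hδ₁1 hcK2 hcK1 hs hδA hα1 hcH hθ n' hd
    have := P.mesh_pos k
    positivity
  calc (P.mesh 0 ^ P.d)⁻¹ * ∑ i' : Ix N,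
        ‖hol C B x₁ Γ (covDeriv C B (op116 C Ω A B msq a k 0 (n' + 1) (cb P N 0 (x', i'))) ⟨x₂, μ⟩)
          - covDeriv C B (op116 C Ω A B msq a k 0 (n' + 1) (cb P N 0 (x', i'))) ⟨x₁, μ⟩‖
      ≤ (P.mesh 0 ^ P.d)⁻¹ * ∑ i' : Ix N,
          (‖holT C B x₁ x₂ Γ μ (propagatorK C Ω B msq a k (srcV C A B k Ω a (propagatorK C Ω B msq a k (f^[n'] (cb P N 0 (x', i'))))))‖
            + ‖hol C B x₁ Γ (covDeriv C B (op116 C Ω A B msq a k 1 (n' + 1) (cb P N 0 (x', i'))) ⟨x₂, μ⟩)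
                - covDeriv C B (op116 C Ω A B msq a k 1 (n' + 1) (cb P N 0 (x', i'))) ⟨x₁, μ⟩‖) :=
        mul_le_mul_of_nonneg_left (Finset.sum_le_sum fun i' _ => hpt i') (inv_nonneg.mpr (pow_nonneg (P.mesh_pos 0).le _))
    _ = (P.mesh 0 ^ P.d)⁻¹ * ∑ i' : Ix N,
            ‖holT C B x₁ x₂ Γ μ (propagatorK C Ω B msq a k (srcV C A B k Ω a (propagatorK C Ω B msq a k (f^[n'] (cb P N 0 (x', i'))))))‖
          + (P.mesh 0 ^ P.d)⁻¹ * ∑ i' : Ix N,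
            ‖hol C B x₁ Γ (covDeriv C B (op116 C Ω A B msq a k 1 (n' + 1) (cb P N 0 (x', i'))) ⟨x₂, μ⟩)
                - covDeriv C B (op116 C Ω A B msq a k 1 (n' + 1) (cb P N 0 (x', i'))) ⟨x₁, μ⟩‖ := by
        rw [Finset.sum_add_distrib, mul_add]
    _ ≤ q * (holCBθ P N C k nF a cK2 cK1 s δA δ₁ α cH θ n' * P.mesh k ^ (n' + 1) * X) *
            Real.exp (-(rateB P N C k nF a cK2 cK1 s δA δ₁ cK2 cK1 (n' + 1) * m))
          + q * (holCBθ P N C k nF a cK2 cK1 s δA δ₁ α cH θ (n' + 1) * P.mesh k ^ (n' + 2) * X) *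
            Real.exp (-(rateB P N C k nF a cK2 cK1 s δA δ₁ cK2 cK1 (n' + 2) * m)) := add_le_add h1 h2
    _ ≤ q * (holCBθ P N C k nF a cK2 cK1 s δA δ₁ α cH θ n' * P.mesh k ^ (n' + 1) * X) *
            Real.exp (-(rateB P N C k nF a cK2 cK1 s δA δ₁ cK2 cK1 (n' + 2) * m))
          + q * (holCBθ P N C k nF a cK2 cK1 s δA δ₁ α cH θ (n' + 1) * P.mesh k ^ (n' + 2) * X) *
            Real.exp (-(rateB P N C k nF a cK2 cK1 s δA δ₁ cK2 cK1 (n' + 2) * m)) :=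
        add_le_add (mul_le_mul_of_nonneg_left hexp hB1) le_rfl
    _ = _ := by ring

/-- **THE `n = 0` HÖLDER MEMBER ON `Ω`, PACKAGED** (`L^kε ≤ 1`): one constant `(holCBθ(n′) + holCBθ(n′+1))·(L^kε)^{n′+1}` — p40's binder `hH` at
`(n, n′) = (0, n′+1)` (`C_H·t^{0+(n′+1)}` with `t ≥ L^kε`), rate `δ_{n′+2}`. [cite: Balaban1983Higgs3, (1.16) p.414, (2.5) p.424, (2.11) p.426, p.433] [cite: Balaban1982Higgs1, (3.44) p.619] -/
theorem kernel116_holder_box_zero_left_margin_le' (hmesh : P.mesh k ≤ 1) (n' : ℕ) (hd : (P.d : ℝ) < 1 + ((n' + 1 : ℕ) : ℝ) - α) :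
    (P.mesh 0 ^ P.d)⁻¹ * ∑ i' : Ix N,
        ‖hol C B x₁ Γ (covDeriv C B (op116 C Ω A B msq a k 0 (n' + 1) (cb P N 0 (x', i'))) ⟨x₂, μ⟩)
          - covDeriv C B (op116 C Ω A B msq a k 0 (n' + 1) (cb P N 0 (x', i'))) ⟨x₁, μ⟩‖
      ≤ q * ((holCBθ P N C k nF a cK2 cK1 s δA δ₁ α cH θ n' + holCBθ P N C k nF a cK2 cK1 s δA δ₁ α cH θ (n' + 1)) * P.mesh k ^ (n' + 1) *
            (P.mesh k * (P.mesh k ^ P.d)⁻¹ * (P.mesh k ^ α)⁻¹)) *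
          Real.exp (-(rateB P N C k nF a cK2 cK1 s δA δ₁ cK2 cK1 (n' + 2) *
            (min (HiggsLattice.Site.tdist x₁ x' : ℝ) (HiggsLattice.Site.tdist x₂ x' : ℝ) / (P.L : ℝ) ^ k))) := by
  refine (kernel116_holder_box_zero_left_margin_le hL hk hkK hmsq ha hak hΩ hcK2 hcK1 hcolB hdcolB hcolAB hdcolAB hδ₁ hδ₁1 hs hA hδA hregA i₀ hF
    hexF henF hx' hx₁ hx₁' hx₂ hx₂' hα0 hα1 hcH hq hθ hH hh₁ hh₂ n' hd).trans ?_
  have hεk := P.mesh_pos k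
  have hd2 : (P.d : ℝ) < 1 + ((n' + 1 + 1 : ℕ) : ℝ) - α := by push_cast at hd ⊢; linarith
  have h0 := holCBθ_nonneg (P := P) (N := N) hL (C := C) k nF (a := a) hδ₁ hδ₁1 hcK2 hcK1 hs hδA hα1 hcH hθ (n' + 1) hd2
  have hpow : P.mesh k ^ (n' + 2) ≤ P.mesh k ^ (n' + 1) := pow_le_pow_of_le_one hεk.le hmesh (by omega)
  have hX0 : 0 ≤ P.mesh k * (P.mesh k ^ P.d)⁻¹ * (P.mesh k ^ α)⁻¹ := by positivity
  have hsum : holCBθ P N C k nF a cK2 cK1 s δA δ₁ α cH θ n' * P.mesh k ^ (n' + 1)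
        + holCBθ P N C k nF a cK2 cK1 s δA δ₁ α cH θ (n' + 1) * P.mesh k ^ (n' + 2)
      ≤ (holCBθ P N C k nF a cK2 cK1 s δA δ₁ α cH θ n' + holCBθ P N C k nF a cK2 cK1 s δA δ₁ α cH θ (n' + 1)) * P.mesh k ^ (n' + 1) := by
    rw [add_mul]
    exact add_le_add le_rfl (mul_le_mul_of_nonneg_left hpow h0)
  exact mul_le_mul_of_nonneg_right (mul_le_mul_of_nonneg_left (mul_le_mul_of_nonneg_right hsum hX0) hq) (Real.exp_nonneg _)

end Zero

/-! ## §6 The (C)-level plugs on a cell-product box `□ = cellBox k K₀ S` -/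

/-- **THE HÖLDER QUOTIENT OF THE ROW DERIVATIVE OF THE KERNEL OF (1.16) ON A CELL-PRODUCT BOX IS UNIFORMLY BOUNDED AND EXPONENTIALLY DECAYING AT
EVERY PAIR OF COLLINEAR BONDS ONE TOP BLOCK INSIDE THE FACES, FOR ALL `n + 1 + n′ + 1 − α > d`, WITH NO SUPPORT CLAUSE ON THE PERTURBATION** (see the
module docstring for the quantifiers): the Hölder binder `hH` of (2.5) for (1.16) on `□`, UNIFORM IN `k`.
[cite: Balaban1983Higgs3, (1.16) p.414, (2.5) p.424, (2.10)-(2.11) p.426, p.433] [cite: Balaban1982Higgs1, Prop. 2.1 (2.24) p.610, p.611 l.1–2, (3.16) p.615] -/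
theorem kernel116_holder_cellBox_margin_le (d L : ℕ) (hd : 1 ≤ d) (hL : 2 ≤ L) {a : ℝ} (ha : 0 < a) {msq : ℝ} (hmsq : 0 < msq) (N : ℕ)
    (C : ChargeData N) :
    ∃ K₀min : ℕ, ∀ {α : ℝ}, 0 ≤ α → α < 1 → ∀ K₀ : ℕ, K₀min ≤ K₀ → ∃ t δ₁ Cst : ℝ, 0 < t ∧ 0 < δ₁ ∧ δ₁ ≤ 1 ∧ 0 < Cst ∧
      ∀ (P : HiggsLattice.Params), 1 < P.L → P.d = d → P.L = L → K₀ ∣ P.M →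
      ∀ {k : ℕ}, 1 ≤ k → k ≤ P.K → (∀ μ, 3 * half P k K₀ ≤ P.sitesPerDir 0 μ) → P.mesh k ≤ 1 →
      ∀ (S : Fin P.d → Finset ℕ) (A B : HiggsLattice.VecField P 0) {s δA δB δAB : ℝ}, 0 ≤ s → 0 ≤ δA → 0 ≤ δB → 0 ≤ δAB →
        (∀ b : HiggsLattice.PBond P 0, |A b| ≤ s) →
        (∀ (z : HiggsLattice.Site P 0) (μ ν : Fin P.d), |A ⟨z.shift ν, μ⟩ - A ⟨z, μ⟩| ≤ δA) →
        (∀ z ∈ cellBox k K₀ S, ∀ μ ν : Fin P.d, |B ⟨z.shift ν, μ⟩ - B ⟨z, μ⟩| ≤ δB) → (P.L : ℝ) ^ k * δB * |C.e| ≤ t →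
        (∀ z ∈ cellBox k K₀ S, ∀ μ ν : Fin P.d, |(A + B) ⟨z.shift ν, μ⟩ - (A + B) ⟨z, μ⟩| ≤ δAB) → (P.L : ℝ) ^ k * δAB * |C.e| ≤ t →
        ∀ (i₀ : Ix N) (n n' : ℕ), (P.d : ℝ) < 1 + ((n + 1 + n' : ℕ) : ℝ) - α →
        ∀ x' ∈ cellBox k K₀ S, ∀ (μ : Fin P.d) (x₁ x₂ : HiggsLattice.Site P 0), x₂ ≠ x₁ →
          x₁ ∈ cellBox k K₀ S → x₁.shift μ ∈ cellBox k K₀ S → x₂ ∈ cellBox k K₀ S → x₂.shift μ ∈ cellBox k K₀ S →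
        ∀ Γ : List (HiggsLattice.Site P 0), IsAdm x₁ x₂ Γ → (∀ z ∈ Γ, z ∈ cellBox k K₀ S) →
        ∀ {θ : ℝ}, 0 < θ → (∀ f ∈ faces k K₀ S, θ * (P.L : ℝ) ^ k ≤ ((min (x₁ f.1 - f.2).val (f.2 - x₁ f.1).val : ℕ) : ℝ)) →
          (∀ f ∈ faces k K₀ S, θ * (P.L : ℝ) ^ k ≤ ((min (x₂ f.1 - f.2).val (f.2 - x₂ f.1).val : ℕ) : ℝ)) →
          (P.mesh 0 ^ P.d)⁻¹ * ∑ i' : Ix N,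
              ‖hol C B x₁ Γ (covDeriv C B (op116 C (cellBox k K₀ S) A B msq a k (n + 1) n' (cb P N 0 (x', i'))) ⟨x₂, μ⟩)
                - covDeriv C B (op116 C (cellBox k K₀ S) A B msq a k (n + 1) n' (cb P N 0 (x', i'))) ⟨x₁, μ⟩‖
            ≤ (P.mesh 0 * (HiggsLattice.Site.tdist x₁ x₂ : ℝ)) ^ α *
                (holCBθ P N C k (faces k K₀ S).card a (P.mesh 0 ^ P.d * Cst) (cK1 P C k Cst s) s δA δ₁ α (P.mesh 0 ^ P.d * Cst) θ (n + n') *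
                  P.mesh k ^ (n + 1 + n') * (P.mesh k * (P.mesh k ^ P.d)⁻¹ * (P.mesh k ^ α)⁻¹)) *
              Real.exp (-(rateB P N C k (faces k K₀ S).card a (P.mesh 0 ^ P.d * Cst) (cK1 P C k Cst s) s δA δ₁ (P.mesh 0 ^ P.d * Cst)
                (cK1 P C k Cst s) (n + 1 + n') *
                (min (HiggsLattice.Site.tdist x₁ x' : ℝ) (HiggsLattice.Site.tdist x₂ x' : ℝ) / (P.L : ℝ) ^ k))) := by
  classical
  obtain ⟨K₁, hbox⟩ := colB_dcolB_le d L hd hL ha hmsq N C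
  obtain ⟨K₂, hhol⟩ := hcolB_le d L hd hL ha hmsq N C
  refine ⟨max K₁ K₂, fun {α} hα0 hα1 K₀ hK₀ => ?_⟩
  obtain ⟨t₁, δ₁, C₁, ht₁, hδ₁, hC₁, hbox⟩ := hbox K₀ ((le_max_left _ _).trans hK₀)
  obtain ⟨t₂, δ₂, C₂, ht₂, hδ₂, hC₂, hhol⟩ := hhol hα0 hα1 K₀ ((le_max_right _ _).trans hK₀)
  -- common window, rate (cut at 1) and constant
  have hδ0 : 0 < min (min δ₁ δ₂) 1 := lt_min (lt_min hδ₁ hδ₂) one_pos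
  have hCst : 0 < max C₁ C₂ := hC₁.trans_le (le_max_left _ _)
  refine ⟨min t₁ t₂, min (min δ₁ δ₂) 1, max C₁ C₂, lt_min ht₁ ht₂, hδ0, min_le_right _ _, hCst, ?_⟩
  intro P hP1 hPd hPL hK₀M k hk1 hkK h3 hmesh S A B s δA δB δAB hs hδA hδB hδAB hA hregA hregB htB hregAB htAB i₀ n n' hdn x' hx' μ x₁ x₂ hne
    hx₁ hx₁μ hx₂ hx₂μ Γ hΓ hΓΩ θ hθ hh₁ hh₂
  set Ω := cellBox k K₀ S with hΩdef
  set δ := min (min δ₁ δ₂) 1 with hδdef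
  set Cst := max C₁ C₂ with hCdef
  have hL1' : (1 : ℝ) < (P.L : ℝ) := by exact_mod_cast hP1
  have hak : 0 ≤ B1.aSeq a P.L k := (B1.aSeq_pos ha hL1' hk1).le
  have hεd : 0 ≤ P.mesh 0 ^ P.d := pow_nonneg (P.mesh_pos 0).le _
  have hc : 0 ≤ P.mesh 0 ^ P.d * Cst := mul_nonneg hεd hCst.le
  have hc₁ : 0 ≤ P.mesh 0 ^ P.d * C₁ := mul_nonneg hεd hC₁.le
  have hc₂ : 0 ≤ P.mesh 0 ^ P.d * C₂ := mul_nonneg hεd hC₂.le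
  have hCle₁ : P.mesh 0 ^ P.d * C₁ ≤ P.mesh 0 ^ P.d * Cst := mul_le_mul_of_nonneg_left (le_max_left _ _) hεd
  have hCle₂ : P.mesh 0 ^ P.d * C₂ ≤ P.mesh 0 ^ P.d * Cst := mul_le_mul_of_nonneg_left (le_max_right _ _) hεd
  have hδle₁ : δ ≤ δ₁ := (min_le_left _ _).trans (min_le_left _ _)
  have hδle₂ : δ ≤ δ₂ := (min_le_left _ _).trans (min_le_right _ _)
  obtain ⟨hcK1', hcK1⟩ := cK1_ge (P := P) (C := C) (k := k) hCst.le hs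
  -- the (2.10) dictionaries of both propagators on the box, at the common rate and constant
  have hB := fun x y hx hy => hbox P hP1 hPd hPL hK₀M hk1 hkK h3 hmesh S B hδB hregB (htB.trans (min_le_left _ _)) x y hx hy
  have hAB := fun x y hx hy => hbox P hP1 hPd hPL hK₀M hk1 hkK h3 hmesh S (A + B) hδAB hregAB (htAB.trans (min_le_left _ _)) x y hx hy
  have hcolB : ∀ x ∈ Ω, ∀ z ∈ Ω, ∑ i : Ix N, ‖propagatorK C Ω B msq a k (cb P N 0 (z, i)) x‖ ≤ maj P k (P.mesh 0 ^ P.d * Cst) 2 δ x z :=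
    fun x hx z hz => (le_trans (hB x z hx hz).1 (maj_rate_mono hc₁ hδle₁ x z)).trans (maj_const_mono hCle₁ x z)
  have hcolAB : ∀ x ∈ Ω, ∀ z ∈ Ω,
      ∑ i : Ix N, ‖propagatorK C Ω (A + B) msq a k (cb P N 0 (z, i)) x‖ ≤ maj P k (P.mesh 0 ^ P.d * Cst) 2 δ x z :=
    fun x hx z hz => (le_trans (hAB x z hx hz).1 (maj_rate_mono hc₁ hδle₁ x z)).trans (maj_const_mono hCle₁ x z)
  have hdcolB : ∀ b : HiggsLattice.PBond P 0, Inside Ω b → ∀ z ∈ Ω,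
      ∑ i : Ix N, ‖covDeriv C B (propagatorK C Ω B msq a k (cb P N 0 (z, i))) b‖ ≤ maj P k (cK1 P C k Cst s) 1 δ b.src z := by
    intro b hb z hz
    have h := (hB b.src z hb.1 hz).2 b.dir hb.2
    exact ((h.trans (maj_rate_mono hc₁ hδle₁ _ z)).trans (maj_const_mono hCle₁ _ z)).trans (maj_const_mono hcK1' _ z)
  have hdcolAB : ∀ b : HiggsLattice.PBond P 0, Inside Ω b → ∀ z ∈ Ω,
      ∑ i : Ix N, ‖covDeriv C B (propagatorK C Ω (A + B) msq a k (cb P N 0 (z, i))) b‖ ≤ maj P k (cK1 P C k Cst s) 1 δ b.src z := by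
    refine dcol_split_le_maj hδ0 (min_le_right _ _) hCst.le hs hA hcolAB (fun b hb z hz => ?_)
    have h := (hAB b.src z hb.1 hz).2 b.dir hb.2
    exact (h.trans (maj_rate_mono hc₁ hδle₁ _ z)).trans (maj_const_mono hCle₁ _ z)
  -- the two-anchor Hölder dictionary of `G_k(□,B)`, multiplied out
  have hqpos : 0 < (P.mesh 0 * (HiggsLattice.Site.tdist x₁ x₂ : ℝ)) ^ α := by
    have h1 : (1 : ℝ) ≤ (HiggsLattice.Site.tdist x₁ x₂ : ℝ) := by exact_mod_cast one_le_tdist_of_ne' hne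
    exact Real.rpow_pos_of_pos (mul_pos (P.mesh_pos 0) (by linarith)) _
  have hH : ∀ y ∈ Ω, ∑ i : Ix N, ‖holT C B x₁ x₂ Γ μ (propagatorK C Ω B msq a k (cb P N 0 (y, i)))‖
      ≤ (P.mesh 0 * (HiggsLattice.Site.tdist x₁ x₂ : ℝ)) ^ α *
          (maj P k (P.mesh 0 ^ P.d * Cst) (1 - α) δ x₁ y + maj P k (P.mesh 0 ^ P.d * Cst) (1 - α) δ x₂ y) := by
    intro y hy
    have h := hhol P hP1 hPd hPL hK₀M hk1 hkK h3 hmesh S B hδB hregB (htB.trans (min_le_right _ _)) μ x₁ x₂ y hne hx₁ hx₁μ hx₂ hx₂μ hy Γ hΓ hΓΩ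
    rw [div_le_iff₀ hqpos] at h
    simp only [holT_apply]
    refine h.trans ?_
    rw [mul_comm]
    refine mul_le_mul_of_nonneg_left ?_ hqpos.le
    have hsplit : ∑ j ∈ Finset.range k, (P.mesh 0 ^ P.d * C₂) * P.mesh j ^ (((1 : ℝ) - α) - (P.d : ℝ)) *
          (Real.exp (-(δ₂ * (P.mesh j)⁻¹ * (P.mesh 0 * (HiggsLattice.Site.tdist x₁ y : ℝ)))) +
            Real.exp (-(δ₂ * (P.mesh j)⁻¹ * (P.mesh 0 * (HiggsLattice.Site.tdist x₂ y : ℝ)))))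
        = maj P k (P.mesh 0 ^ P.d * C₂) (1 - α) δ₂ x₁ y + maj P k (P.mesh 0 ^ P.d * C₂) (1 - α) δ₂ x₂ y := by
      unfold maj
      rw [← Finset.sum_add_distrib]
      exact Finset.sum_congr rfl fun j _ => by ring
    rw [hsplit]
    exact add_le_add ((maj_rate_mono hc₂ hδle₂ x₁ y).trans (maj_const_mono hCle₂ x₁ y))
      ((maj_rate_mono hc₂ hδle₂ x₂ y).trans (maj_const_mono hCle₂ x₂ y))
  exact kernel116_holder_box_margin_le hP1 hk1 hkK hmsq hak (cellBox_blockUnion le_rfl S) hc hcK1 hcolB hdcolB hcolAB hdcolAB hδ0 (min_le_right _ _)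
    hs hA hδA hregA i₀ (faceFam_level k K₀ S) (exB_cover_cellBox k K₀ S A) (enB_cover_cellBox k K₀ S A) hx' hx₁ hx₁μ hx₂ hx₂μ hα0 hα1 hc hqpos.le
    hθ hH (height_faceFam k K₀ S hh₁) (height_faceFam k K₀ S hh₂) n n' hdn

/-- **THE `n = 0` CORNER ON A CELL-PRODUCT BOX** (outer factor `G_k(□,Ã+B̃)`, orders `(0, n′+1)` with `d < 1 + (n′+1) − α`): the Hölder binder `hH`
of (2.5) for (1.16) on `□` at `(0, n′+1)`, constant `(holCBθ(n′) + holCBθ(n′+1))·(L^kε)^{n′+1}`, rate `δ_{n′+2}`, UNIFORM IN `k`, no support clause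
on `Ã`. [cite: Balaban1983Higgs3, (1.16) p.414, (2.5) p.424, (2.10)-(2.11) p.426, p.433] [cite: Balaban1982Higgs1, (3.44) p.619, Prop. 2.1 (2.24) p.610, p.611 l.1–2] -/
theorem kernel116_holder_cellBox_zero_left_margin_le (d L : ℕ) (hd : 1 ≤ d) (hL : 2 ≤ L) {a : ℝ} (ha : 0 < a) {msq : ℝ} (hmsq : 0 < msq) (N : ℕ)
    (C : ChargeData N) :
    ∃ K₀min : ℕ, ∀ {α : ℝ}, 0 ≤ α → α < 1 → ∀ K₀ : ℕ, K₀min ≤ K₀ → ∃ t δ₁ Cst : ℝ, 0 < t ∧ 0 < δ₁ ∧ δ₁ ≤ 1 ∧ 0 < Cst ∧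
      ∀ (P : HiggsLattice.Params), 1 < P.L → P.d = d → P.L = L → K₀ ∣ P.M →
      ∀ {k : ℕ}, 1 ≤ k → k ≤ P.K → (∀ μ, 3 * half P k K₀ ≤ P.sitesPerDir 0 μ) → P.mesh k ≤ 1 →
      ∀ (S : Fin P.d → Finset ℕ) (A B : HiggsLattice.VecField P 0) {s δA δB δAB : ℝ}, 0 ≤ s → 0 ≤ δA → 0 ≤ δB → 0 ≤ δAB →
        (∀ b : HiggsLattice.PBond P 0, |A b| ≤ s) →
        (∀ (z : HiggsLattice.Site P 0) (μ ν : Fin P.d), |A ⟨z.shift ν, μ⟩ - A ⟨z, μ⟩| ≤ δA) →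
        (∀ z ∈ cellBox k K₀ S, ∀ μ ν : Fin P.d, |B ⟨z.shift ν, μ⟩ - B ⟨z, μ⟩| ≤ δB) → (P.L : ℝ) ^ k * δB * |C.e| ≤ t →
        (∀ z ∈ cellBox k K₀ S, ∀ μ ν : Fin P.d, |(A + B) ⟨z.shift ν, μ⟩ - (A + B) ⟨z, μ⟩| ≤ δAB) → (P.L : ℝ) ^ k * δAB * |C.e| ≤ t →
        ∀ (i₀ : Ix N) (n' : ℕ), (P.d : ℝ) < 1 + ((n' + 1 : ℕ) : ℝ) - α →
        ∀ x' ∈ cellBox k K₀ S, ∀ (μ : Fin P.d) (x₁ x₂ : HiggsLattice.Site P 0), x₂ ≠ x₁ →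
          x₁ ∈ cellBox k K₀ S → x₁.shift μ ∈ cellBox k K₀ S → x₂ ∈ cellBox k K₀ S → x₂.shift μ ∈ cellBox k K₀ S →
        ∀ Γ : List (HiggsLattice.Site P 0), IsAdm x₁ x₂ Γ → (∀ z ∈ Γ, z ∈ cellBox k K₀ S) →
        ∀ {θ : ℝ}, 0 < θ → (∀ f ∈ faces k K₀ S, θ * (P.L : ℝ) ^ k ≤ ((min (x₁ f.1 - f.2).val (f.2 - x₁ f.1).val : ℕ) : ℝ)) →
          (∀ f ∈ faces k K₀ S, θ * (P.L : ℝ) ^ k ≤ ((min (x₂ f.1 - f.2).val (f.2 - x₂ f.1).val : ℕ) : ℝ)) →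
          (P.mesh 0 ^ P.d)⁻¹ * ∑ i' : Ix N,
              ‖hol C B x₁ Γ (covDeriv C B (op116 C (cellBox k K₀ S) A B msq a k 0 (n' + 1) (cb P N 0 (x', i'))) ⟨x₂, μ⟩)
                - covDeriv C B (op116 C (cellBox k K₀ S) A B msq a k 0 (n' + 1) (cb P N 0 (x', i'))) ⟨x₁, μ⟩‖
            ≤ (P.mesh 0 * (HiggsLattice.Site.tdist x₁ x₂ : ℝ)) ^ α *
                ((holCBθ P N C k (faces k K₀ S).card a (P.mesh 0 ^ P.d * Cst) (cK1 P C k Cst s) s δA δ₁ α (P.mesh 0 ^ P.d * Cst) θ n'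
                    + holCBθ P N C k (faces k K₀ S).card a (P.mesh 0 ^ P.d * Cst) (cK1 P C k Cst s) s δA δ₁ α (P.mesh 0 ^ P.d * Cst) θ (n' + 1)) *
                  P.mesh k ^ (n' + 1) * (P.mesh k * (P.mesh k ^ P.d)⁻¹ * (P.mesh k ^ α)⁻¹)) *
              Real.exp (-(rateB P N C k (faces k K₀ S).card a (P.mesh 0 ^ P.d * Cst) (cK1 P C k Cst s) s δA δ₁ (P.mesh 0 ^ P.d * Cst)
                (cK1 P C k Cst s) (n' + 2) *
                (min (HiggsLattice.Site.tdist x₁ x' : ℝ) (HiggsLattice.Site.tdist x₂ x' : ℝ) / (P.L : ℝ) ^ k))) := by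
  classical
  obtain ⟨K₁, hbox⟩ := colB_dcolB_le d L hd hL ha hmsq N C
  obtain ⟨K₂, hhol⟩ := hcolB_le d L hd hL ha hmsq N C
  refine ⟨max K₁ K₂, fun {α} hα0 hα1 K₀ hK₀ => ?_⟩
  obtain ⟨t₁, δ₁, C₁, ht₁, hδ₁, hC₁, hbox⟩ := hbox K₀ ((le_max_left _ _).trans hK₀)
  obtain ⟨t₂, δ₂, C₂, ht₂, hδ₂, hC₂, hhol⟩ := hhol hα0 hα1 K₀ ((le_max_right _ _).trans hK₀)
  -- common window, rate (cut at 1) and constant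
  have hδ0 : 0 < min (min δ₁ δ₂) 1 := lt_min (lt_min hδ₁ hδ₂) one_pos
  have hCst : 0 < max C₁ C₂ := hC₁.trans_le (le_max_left _ _)
  refine ⟨min t₁ t₂, min (min δ₁ δ₂) 1, max C₁ C₂, lt_min ht₁ ht₂, hδ0, min_le_right _ _, hCst, ?_⟩
  intro P hP1 hPd hPL hK₀M k hk1 hkK h3 hmesh S A B s δA δB δAB hs hδA hδB hδAB hA hregA hregB htB hregAB htAB i₀ n' hdn x' hx' μ x₁ x₂ hne
    hx₁ hx₁μ hx₂ hx₂μ Γ hΓ hΓΩ θ hθ hh₁ hh₂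
  set Ω := cellBox k K₀ S with hΩdef
  set δ := min (min δ₁ δ₂) 1 with hδdef
  set Cst := max C₁ C₂ with hCdef
  have hL1' : (1 : ℝ) < (P.L : ℝ) := by exact_mod_cast hP1
  have hak : 0 ≤ B1.aSeq a P.L k := (B1.aSeq_pos ha hL1' hk1).le
  have hεd : 0 ≤ P.mesh 0 ^ P.d := pow_nonneg (P.mesh_pos 0).le _
  have hc : 0 ≤ P.mesh 0 ^ P.d * Cst := mul_nonneg hεd hCst.le
  have hc₁ : 0 ≤ P.mesh 0 ^ P.d * C₁ := mul_nonneg hεd hC₁.le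
  have hc₂ : 0 ≤ P.mesh 0 ^ P.d * C₂ := mul_nonneg hεd hC₂.le
  have hCle₁ : P.mesh 0 ^ P.d * C₁ ≤ P.mesh 0 ^ P.d * Cst := mul_le_mul_of_nonneg_left (le_max_left _ _) hεd
  have hCle₂ : P.mesh 0 ^ P.d * C₂ ≤ P.mesh 0 ^ P.d * Cst := mul_le_mul_of_nonneg_left (le_max_right _ _) hεd
  have hδle₁ : δ ≤ δ₁ := (min_le_left _ _).trans (min_le_left _ _)
  have hδle₂ : δ ≤ δ₂ := (min_le_left _ _).trans (min_le_right _ _)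
  obtain ⟨hcK1', hcK1⟩ := cK1_ge (P := P) (C := C) (k := k) hCst.le hs
  -- the (2.10) dictionaries of both propagators on the box, at the common rate and constant
  have hB := fun x y hx hy => hbox P hP1 hPd hPL hK₀M hk1 hkK h3 hmesh S B hδB hregB (htB.trans (min_le_left _ _)) x y hx hy
  have hAB := fun x y hx hy => hbox P hP1 hPd hPL hK₀M hk1 hkK h3 hmesh S (A + B) hδAB hregAB (htAB.trans (min_le_left _ _)) x y hx hy
  have hcolB : ∀ x ∈ Ω, ∀ z ∈ Ω, ∑ i : Ix N, ‖propagatorK C Ω B msq a k (cb P N 0 (z, i)) x‖ ≤ maj P k (P.mesh 0 ^ P.d * Cst) 2 δ x z :=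
    fun x hx z hz => (le_trans (hB x z hx hz).1 (maj_rate_mono hc₁ hδle₁ x z)).trans (maj_const_mono hCle₁ x z)
  have hcolAB : ∀ x ∈ Ω, ∀ z ∈ Ω,
      ∑ i : Ix N, ‖propagatorK C Ω (A + B) msq a k (cb P N 0 (z, i)) x‖ ≤ maj P k (P.mesh 0 ^ P.d * Cst) 2 δ x z :=
    fun x hx z hz => (le_trans (hAB x z hx hz).1 (maj_rate_mono hc₁ hδle₁ x z)).trans (maj_const_mono hCle₁ x z)
  have hdcolB : ∀ b : HiggsLattice.PBond P 0, Inside Ω b → ∀ z ∈ Ω,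
      ∑ i : Ix N, ‖covDeriv C B (propagatorK C Ω B msq a k (cb P N 0 (z, i))) b‖ ≤ maj P k (cK1 P C k Cst s) 1 δ b.src z := by
    intro b hb z hz
    have h := (hB b.src z hb.1 hz).2 b.dir hb.2
    exact ((h.trans (maj_rate_mono hc₁ hδle₁ _ z)).trans (maj_const_mono hCle₁ _ z)).trans (maj_const_mono hcK1' _ z)
  have hdcolAB : ∀ b : HiggsLattice.PBond P 0, Inside Ω b → ∀ z ∈ Ω,
      ∑ i : Ix N, ‖covDeriv C B (propagatorK C Ω (A + B) msq a k (cb P N 0 (z, i))) b‖ ≤ maj P k (cK1 P C k Cst s) 1 δ b.src z := by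
    refine dcol_split_le_maj hδ0 (min_le_right _ _) hCst.le hs hA hcolAB (fun b hb z hz => ?_)
    have h := (hAB b.src z hb.1 hz).2 b.dir hb.2
    exact (h.trans (maj_rate_mono hc₁ hδle₁ _ z)).trans (maj_const_mono hCle₁ _ z)
  -- the two-anchor Hölder dictionary of `G_k(□,B)`, multiplied out
  have hqpos : 0 < (P.mesh 0 * (HiggsLattice.Site.tdist x₁ x₂ : ℝ)) ^ α := by
    have h1 : (1 : ℝ) ≤ (HiggsLattice.Site.tdist x₁ x₂ : ℝ) := by exact_mod_cast one_le_tdist_of_ne' hne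
    exact Real.rpow_pos_of_pos (mul_pos (P.mesh_pos 0) (by linarith)) _
  have hH : ∀ y ∈ Ω, ∑ i : Ix N, ‖holT C B x₁ x₂ Γ μ (propagatorK C Ω B msq a k (cb P N 0 (y, i)))‖
      ≤ (P.mesh 0 * (HiggsLattice.Site.tdist x₁ x₂ : ℝ)) ^ α *
          (maj P k (P.mesh 0 ^ P.d * Cst) (1 - α) δ x₁ y + maj P k (P.mesh 0 ^ P.d * Cst) (1 - α) δ x₂ y) := by
    intro y hy
    have h := hhol P hP1 hPd hPL hK₀M hk1 hkK h3 hmesh S B hδB hregB (htB.trans (min_le_right _ _)) μ x₁ x₂ y hne hx₁ hx₁μ hx₂ hx₂μ hy Γ hΓ hΓΩ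
    rw [div_le_iff₀ hqpos] at h
    simp only [holT_apply]
    refine h.trans ?_
    rw [mul_comm]
    refine mul_le_mul_of_nonneg_left ?_ hqpos.le
    have hsplit : ∑ j ∈ Finset.range k, (P.mesh 0 ^ P.d * C₂) * P.mesh j ^ (((1 : ℝ) - α) - (P.d : ℝ)) *
          (Real.exp (-(δ₂ * (P.mesh j)⁻¹ * (P.mesh 0 * (HiggsLattice.Site.tdist x₁ y : ℝ)))) +
            Real.exp (-(δ₂ * (P.mesh j)⁻¹ * (P.mesh 0 * (HiggsLattice.Site.tdist x₂ y : ℝ)))))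
        = maj P k (P.mesh 0 ^ P.d * C₂) (1 - α) δ₂ x₁ y + maj P k (P.mesh 0 ^ P.d * C₂) (1 - α) δ₂ x₂ y := by
      unfold maj
      rw [← Finset.sum_add_distrib]
      exact Finset.sum_congr rfl fun j _ => by ring
    rw [hsplit]
    exact add_le_add ((maj_rate_mono hc₂ hδle₂ x₁ y).trans (maj_const_mono hCle₂ x₁ y))
      ((maj_rate_mono hc₂ hδle₂ x₂ y).trans (maj_const_mono hCle₂ x₂ y))
  exact kernel116_holder_box_zero_left_margin_le' hP1 hk1 hkK hmsq ha hak (cellBox_blockUnion le_rfl S) hc hcK1 hcolB hdcolB hcolAB hdcolAB hδ0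
    (min_le_right _ _) hs hA hδA hregA i₀ (faceFam_level k K₀ S) (exB_cover_cellBox k K₀ S A) (enB_cover_cellBox k K₀ S A) hx' hx₁ hx₁μ hx₂ hx₂μ
    hα0 hα1 hc hqpos.le hθ hH (height_faceFam k K₀ S hh₁) (height_faceFam k K₀ S hh₂) hmesh n' hdn

/-! ## §7 The Hölder binders at `Interior` anchors (p40's `hH` shape, contour inside the box) -/

section InteriorBinder

open B3Ineq210RegularRegion (Interior)
open B3Op116CellBoxFaceFamily (inside_of_interior faces_height_of_interior)

/-- **THE HÖLDER MEMBER ON A CELL-PRODUCT BOX AT `Interior` ANCHORS** — `kernel116_holder_cellBox_margin_le` with the bond and height hypotheses of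
both anchors discharged by `Interior k K₀ □ x₁`, `Interior k K₀ □ x₂` (`θ = 1`; `K₀,min ≥ 1`): p40's binder `hH` of `ineq25At_op116_smooth_of_bounds`
on `Ω = □` at orders `(n+1, n′)`, except that the admissible contour is required to lie in `□` (the two-anchor dictionary `hcolB_le` reads `U(B(Γ))`
inside the box) and `x′ ∈ □` suffices. [cite: Balaban1983Higgs3, (1.16) p.414, (2.5) p.424, (2.11) p.426, p.433] [cite: Balaban1982Higgs1, Prop. 2.1 (2.24) p.610] -/
theorem kernel116_holder_cellBox_interior_le (d L : ℕ) (hd : 1 ≤ d) (hL : 2 ≤ L) {a : ℝ} (ha : 0 < a) {msq : ℝ} (hmsq : 0 < msq) (N : ℕ)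
    (C : ChargeData N) :
    ∃ K₀min : ℕ, ∀ {α : ℝ}, 0 ≤ α → α < 1 → ∀ K₀ : ℕ, K₀min ≤ K₀ → ∃ t δ₁ Cst : ℝ, 0 < t ∧ 0 < δ₁ ∧ δ₁ ≤ 1 ∧ 0 < Cst ∧
      ∀ (P : HiggsLattice.Params), 1 < P.L → P.d = d → P.L = L → K₀ ∣ P.M →
      ∀ {k : ℕ}, 1 ≤ k → k ≤ P.K → (∀ μ, 3 * half P k K₀ ≤ P.sitesPerDir 0 μ) → P.mesh k ≤ 1 →
      ∀ (S : Fin P.d → Finset ℕ) (A B : HiggsLattice.VecField P 0) {s δA δB δAB : ℝ}, 0 ≤ s → 0 ≤ δA → 0 ≤ δB → 0 ≤ δAB →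
        (∀ b : HiggsLattice.PBond P 0, |A b| ≤ s) →
        (∀ (z : HiggsLattice.Site P 0) (μ ν : Fin P.d), |A ⟨z.shift ν, μ⟩ - A ⟨z, μ⟩| ≤ δA) →
        (∀ z ∈ cellBox k K₀ S, ∀ μ ν : Fin P.d, |B ⟨z.shift ν, μ⟩ - B ⟨z, μ⟩| ≤ δB) → (P.L : ℝ) ^ k * δB * |C.e| ≤ t →
        (∀ z ∈ cellBox k K₀ S, ∀ μ ν : Fin P.d, |(A + B) ⟨z.shift ν, μ⟩ - (A + B) ⟨z, μ⟩| ≤ δAB) → (P.L : ℝ) ^ k * δAB * |C.e| ≤ t →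
        ∀ (i₀ : Ix N) (n n' : ℕ), (P.d : ℝ) < 1 + ((n + 1 + n' : ℕ) : ℝ) - α →
        ∀ x' ∈ cellBox k K₀ S, ∀ (μ : Fin P.d) (x₁ x₂ : HiggsLattice.Site P 0), x₂ ≠ x₁ →
          Interior k K₀ (cellBox k K₀ S) x₁ → Interior k K₀ (cellBox k K₀ S) x₂ →
        ∀ Γ : List (HiggsLattice.Site P 0), IsAdm x₁ x₂ Γ → (∀ z ∈ Γ, z ∈ cellBox k K₀ S) →
          (P.mesh 0 ^ P.d)⁻¹ * ∑ i' : Ix N,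
              ‖hol C B x₁ Γ (covDeriv C B (op116 C (cellBox k K₀ S) A B msq a k (n + 1) n' (cb P N 0 (x', i'))) ⟨x₂, μ⟩)
                - covDeriv C B (op116 C (cellBox k K₀ S) A B msq a k (n + 1) n' (cb P N 0 (x', i'))) ⟨x₁, μ⟩‖
            ≤ (P.mesh 0 * (HiggsLattice.Site.tdist x₁ x₂ : ℝ)) ^ α *
                (holCBθ P N C k (faces k K₀ S).card a (P.mesh 0 ^ P.d * Cst) (cK1 P C k Cst s) s δA δ₁ α (P.mesh 0 ^ P.d * Cst) 1 (n + n') *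
                  P.mesh k ^ (n + 1 + n') * (P.mesh k * (P.mesh k ^ P.d)⁻¹ * (P.mesh k ^ α)⁻¹)) *
              Real.exp (-(rateB P N C k (faces k K₀ S).card a (P.mesh 0 ^ P.d * Cst) (cK1 P C k Cst s) s δA δ₁ (P.mesh 0 ^ P.d * Cst)
                (cK1 P C k Cst s) (n + 1 + n') *
                (min (HiggsLattice.Site.tdist x₁ x' : ℝ) (HiggsLattice.Site.tdist x₂ x' : ℝ) / (P.L : ℝ) ^ k))) := by
  obtain ⟨K₀min, h⟩ := kernel116_holder_cellBox_margin_le d L hd hL ha hmsq N C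
  refine ⟨max K₀min 1, fun {α} hα0 hα1 K₀ hK₀ => ?_⟩
  obtain ⟨t, δ₁, Cst, ht, hδ₁, hδ₁1, hCst, h⟩ := h hα0 hα1 K₀ ((le_max_left _ _).trans hK₀)
  refine ⟨t, δ₁, Cst, ht, hδ₁, hδ₁1, hCst, ?_⟩
  intro P hP1 hPd hPL hK₀M k hk1 hkK h3 hmesh S A B s δA δB δAB hs hδA hδB hδAB hA hregA hregB htB hregAB htAB i₀ n n' hdn x' hx' μ x₁ x₂ hne
    hx₁ hx₂ Γ hΓ hΓΩ
  have hK₀1 : 1 ≤ K₀ := (le_max_right _ _).trans hK₀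
  exact h P hP1 hPd hPL hK₀M hk1 hkK h3 hmesh S A B hs hδA hδB hδAB hA hregA hregB htB hregAB htAB i₀ n n' hdn x' hx' μ x₁ x₂ hne
    (inside_of_interior hx₁ μ).1 (inside_of_interior hx₁ μ).2 (inside_of_interior hx₂ μ).1 (inside_of_interior hx₂ μ).2 Γ hΓ hΓΩ one_pos
    (faces_height_of_interior hK₀1 hx₁) (faces_height_of_interior hK₀1 hx₂)

/-- **THE `n = 0` CORNER AT `Interior` ANCHORS** — `kernel116_holder_cellBox_zero_left_margin_le` with `Interior k K₀ □ x₁, x₂` (`θ = 1`): p40's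
binder `hH` at `(0, n′+1)`, contour inside the box. [cite: Balaban1983Higgs3, (1.16) p.414, (2.5) p.424, (2.11) p.426, p.433] [cite: Balaban1982Higgs1, (3.44) p.619, Prop. 2.1 (2.24) p.610] -/
theorem kernel116_holder_cellBox_zero_left_interior_le (d L : ℕ) (hd : 1 ≤ d) (hL : 2 ≤ L) {a : ℝ} (ha : 0 < a) {msq : ℝ} (hmsq : 0 < msq)
    (N : ℕ) (C : ChargeData N) :
    ∃ K₀min : ℕ, ∀ {α : ℝ}, 0 ≤ α → α < 1 → ∀ K₀ : ℕ, K₀min ≤ K₀ → ∃ t δ₁ Cst : ℝ, 0 < t ∧ 0 < δ₁ ∧ δ₁ ≤ 1 ∧ 0 < Cst ∧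
      ∀ (P : HiggsLattice.Params), 1 < P.L → P.d = d → P.L = L → K₀ ∣ P.M →
      ∀ {k : ℕ}, 1 ≤ k → k ≤ P.K → (∀ μ, 3 * half P k K₀ ≤ P.sitesPerDir 0 μ) → P.mesh k ≤ 1 →
      ∀ (S : Fin P.d → Finset ℕ) (A B : HiggsLattice.VecField P 0) {s δA δB δAB : ℝ}, 0 ≤ s → 0 ≤ δA → 0 ≤ δB → 0 ≤ δAB →
        (∀ b : HiggsLattice.PBond P 0, |A b| ≤ s) →
        (∀ (z : HiggsLattice.Site P 0) (μ ν : Fin P.d), |A ⟨z.shift ν, μ⟩ - A ⟨z, μ⟩| ≤ δA) →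
        (∀ z ∈ cellBox k K₀ S, ∀ μ ν : Fin P.d, |B ⟨z.shift ν, μ⟩ - B ⟨z, μ⟩| ≤ δB) → (P.L : ℝ) ^ k * δB * |C.e| ≤ t →
        (∀ z ∈ cellBox k K₀ S, ∀ μ ν : Fin P.d, |(A + B) ⟨z.shift ν, μ⟩ - (A + B) ⟨z, μ⟩| ≤ δAB) → (P.L : ℝ) ^ k * δAB * |C.e| ≤ t →
        ∀ (i₀ : Ix N) (n' : ℕ), (P.d : ℝ) < 1 + ((n' + 1 : ℕ) : ℝ) - α →
        ∀ x' ∈ cellBox k K₀ S, ∀ (μ : Fin P.d) (x₁ x₂ : HiggsLattice.Site P 0), x₂ ≠ x₁ →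
          Interior k K₀ (cellBox k K₀ S) x₁ → Interior k K₀ (cellBox k K₀ S) x₂ →
        ∀ Γ : List (HiggsLattice.Site P 0), IsAdm x₁ x₂ Γ → (∀ z ∈ Γ, z ∈ cellBox k K₀ S) →
          (P.mesh 0 ^ P.d)⁻¹ * ∑ i' : Ix N,
              ‖hol C B x₁ Γ (covDeriv C B (op116 C (cellBox k K₀ S) A B msq a k 0 (n' + 1) (cb P N 0 (x', i'))) ⟨x₂, μ⟩)
                - covDeriv C B (op116 C (cellBox k K₀ S) A B msq a k 0 (n' + 1) (cb P N 0 (x', i'))) ⟨x₁, μ⟩‖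
            ≤ (P.mesh 0 * (HiggsLattice.Site.tdist x₁ x₂ : ℝ)) ^ α *
                ((holCBθ P N C k (faces k K₀ S).card a (P.mesh 0 ^ P.d * Cst) (cK1 P C k Cst s) s δA δ₁ α (P.mesh 0 ^ P.d * Cst) 1 n'
                    + holCBθ P N C k (faces k K₀ S).card a (P.mesh 0 ^ P.d * Cst) (cK1 P C k Cst s) s δA δ₁ α (P.mesh 0 ^ P.d * Cst) 1 (n' + 1)) *
                  P.mesh k ^ (n' + 1) * (P.mesh k * (P.mesh k ^ P.d)⁻¹ * (P.mesh k ^ α)⁻¹)) *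
              Real.exp (-(rateB P N C k (faces k K₀ S).card a (P.mesh 0 ^ P.d * Cst) (cK1 P C k Cst s) s δA δ₁ (P.mesh 0 ^ P.d * Cst)
                (cK1 P C k Cst s) (n' + 2) *
                (min (HiggsLattice.Site.tdist x₁ x' : ℝ) (HiggsLattice.Site.tdist x₂ x' : ℝ) / (P.L : ℝ) ^ k))) := by
  obtain ⟨K₀min, h⟩ := kernel116_holder_cellBox_zero_left_margin_le d L hd hL ha hmsq N C
  refine ⟨max K₀min 1, fun {α} hα0 hα1 K₀ hK₀ => ?_⟩
  obtain ⟨t, δ₁, Cst, ht, hδ₁, hδ₁1, hCst, h⟩ := h hα0 hα1 K₀ ((le_max_left _ _).trans hK₀)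
  refine ⟨t, δ₁, Cst, ht, hδ₁, hδ₁1, hCst, ?_⟩
  intro P hP1 hPd hPL hK₀M k hk1 hkK h3 hmesh S A B s δA δB δAB hs hδA hδB hδAB hA hregA hregB htB hregAB htAB i₀ n' hdn x' hx' μ x₁ x₂ hne
    hx₁ hx₂ Γ hΓ hΓΩ
  have hK₀1 : 1 ≤ K₀ := (le_max_right _ _).trans hK₀
  exact h P hP1 hPd hPL hK₀M hk1 hkK h3 hmesh S A B hs hδA hδB hδAB hA hregA hregB htB hregAB htAB i₀ n' hdn x' hx' μ x₁ x₂ hne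
    (inside_of_interior hx₁ μ).1 (inside_of_interior hx₁ μ).2 (inside_of_interior hx₂ μ).1 (inside_of_interior hx₂ μ).2 Γ hΓ hΓΩ one_pos
    (faces_height_of_interior hK₀1 hx₁) (faces_height_of_interior hK₀1 hx₂)

end InteriorBinder

end Literature.MathematicalPhysics.QuantumFieldTheory.Balaban1983to89.B3Op116HolderKernelRegularBox

end
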